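import Literature.MathematicalPhysics.QuantumManyBody.PeriodicBoseGasKineticMultiplier
import Literature.MathematicalPhysics.QuantumManyBody.PeriodicBoseGasLemma32
import Mathlib.MeasureTheory.Integral.MeanInequalities
import HarnessLib

/-!
# Fournais 2020, Lemma 3.3 from the multiplier bound (3.21)

Topic `Literature/MathematicalPhysics/QuantumManyBody`, sibling of `PeriodicBoseGasLocalization.lean`
(provefact `Literature.MathematicalPhysics.QuantumManyBody.BoseGas.Fournais2020_condensation`). We prove
`Fournais2020_lemma33_of_eq321 : Fournais2020_eq321 → Fournais2020_lemma33`: the kinetic-energy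
sliding inequality [Fournais2020, Lemma 3.3 (3.12)–(3.13)] follows from the multiplier bound
(3.21) (`Fournais2020_eq321`, `PeriodicBoseGasKineticMultiplier.lean`) by the diagonalisation
(3.19)–(3.20) of the `u`-averaged localised kinetic energy in the plane waves of the torus.

## The argument [(3.14), (3.19)–(3.21), pp. 16–17]

For a trigonometric polynomial `P = ∑ₙ αₙ e_n` on the torus of side `L` (`e_n = e^{2πin·x/L}`):

1. *Covariance* (`fourier_locProjQ_cellWave`). `Λ(u) = u + Λ(0)`, `χ_u = χ_0(· - u)` and
   `e_n(x) = e_n(u)e_n(x-u)` give `χ_u Q_u e_n = e_n(u) (χ_0Q_0e_n)(· - u)`, whence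
   `|𝓕(χ_uQ_uP)(p)| = |∑ₙ αₙ 𝓕(χ_0Q_0e_n)(p) e_n(u)|` and `|Q_uP(u+y)| = |∑ₙ αₙ (Q_0e_n)(y) e_n(u)|`.
2. *Orthogonality in `u`* (`lintegral_cell_normSq_trigPoly`). `∫_Ω |∑ₙ βₙ e_n(u)|² du = L³∑ₙ|βₙ|²`
   (Parseval on the cell, `PeriodicBoseGasFourier.lean`), so that, by Tonelli,
   `∫_Ω ⟨P, T_u P⟩ du = L³ ∑ₙ |αₙ|² ⟨e_n, T_0 e_n⟩ = L³ℓ³ ∑ₙ |αₙ|² F(n)` — this is (3.19)–(3.20).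
3. *General `φ`* (`C¹`, periodic). For the cubic partial sums `S_Nφ → φ` and `∇S_Nφ = S_N∇φ → ∇φ`
   in `L²(Ω)`; `⟨φ,T_uφ⟩ ≤ liminf_N ⟨S_Nφ, T_u S_Nφ⟩` for every `u` (Fatou in `p` for the Fourier
   side, `|𝓕f - 𝓕g| ≤ ‖f-g‖₁`; Minkowski for `‖Q_u·‖₂`; `‖·‖_{L²(Λ(u))} ≤ ‖·‖_{L²(Ω)}` for periodic
   functions since `ℓ < L`), and Fatou in `u`.
4. *Assembly.* With (3.21) in the form `F(n) + 2π²L⁻² ≤ 4π²|n|²/L²` (`n ≠ 0`), `F(0) = 0`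
   (`Q_u 1 = 0`), Parseval for `φ`, its mean and its gradient:
   `ℓ⁻³∫_Ω⟨φ,T_uφ⟩du + 2π²L⁻²‖φ‖² ≤ L³∑ₙ(F(n) + 2π²L⁻²)|ĉₙ|² ≤ L³(2π²L⁻²|ĉ₀|² + ∑ₙ 4π²|n|²L⁻²|ĉₙ|²)
   = 2π²L⁻² L⁻³|∫_Ω φ|² + ∫_Ω|∇φ|²`.

## References

* [Fournais2020] S. Fournais, *Length scales for BEC in the dilute Bose gas*, arXiv:2011.00309,
  EMS Ser. Congr. Rep. 18 (2021): Lemma 3.3, (3.12)–(3.13), (3.18)–(3.21).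
-/

noncomputable section

open MeasureTheory Filter Set WithLp Complex FourierTransform
open scoped ENNReal NNReal Topology ComplexConjugate

namespace Literature.MathematicalPhysics.QuantumManyBody.BoseGas

/-! ### Boxes: translation, volume, and periodic functions on a box -/

section Boxes

variable {ℓ L : ℝ}

/-- `x ∈ Λ(u) ↔ x - u ∈ Λ(0)`. [cite: Fournais2020, (3.4)] -/
theorem mem_slidingBox_iff_sub (ℓ : ℝ) (u x : Space) :
    x ∈ slidingBox ℓ u ↔ x - u ∈ slidingBox ℓ 0 := by
  simp [slidingBox]

/-- `u + y ∈ Λ(u) ↔ y ∈ Λ(0)`. [cite: Fournais2020, (3.4)] -/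
theorem add_mem_slidingBox_iff (ℓ : ℝ) (u y : Space) :
    u + y ∈ slidingBox ℓ u ↔ y ∈ slidingBox ℓ 0 := by
  rw [mem_slidingBox_iff_sub, add_sub_cancel_left]

/-- `|Λ(u)| = ℓ³`. [cite: Fournais2020, (3.4)] -/
theorem volume_slidingBox (ℓ : ℝ) (u : Space) :
    volume (slidingBox ℓ u) = ENNReal.ofReal ℓ ^ 3 := by
  have h : slidingBox ℓ u = (@ofLp 2 (Fin 3 → ℝ)) ⁻¹'
      (Set.univ.pi fun k => Set.Icc (u k + -ℓ / 2) (u k + ℓ / 2)) := by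
    ext x
    simp only [slidingBox, Set.mem_Icc, Set.mem_setOf_eq, Set.mem_preimage, Set.mem_pi,
      Set.mem_univ, forall_const]
    refine forall_congr' fun k => ?_
    constructor <;> rintro ⟨h1, h2⟩ <;> constructor <;> linarith
  rw [h, (PiLp.volume_preserving_ofLp (Fin 3)).measure_preimage
    (MeasurableSet.univ_pi fun _ => measurableSet_Icc).nullMeasurableSet, volume_pi_pi]
  have hk : ∀ k, u.ofLp k + ℓ / 2 - (u.ofLp k + -ℓ / 2) = ℓ := fun k => by ring
  simp only [Real.volume_Icc, hk, Finset.prod_const, Finset.card_univ, Fintype.card_fin]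

/-- Two lattice translates of a point cannot both lie in a box of side `ℓ < L`.
[cite: Fournais2020, (3.4)] -/
theorem latticeVec_eq_of_mem_slidingBox (hℓ : 0 ≤ ℓ) (hℓL : ℓ < L) {w u : Space} {m n : Fin 3 → ℤ}
    (hm : u - latticeVec L m ∈ slidingBox ℓ w) (hn : u - latticeVec L n ∈ slidingBox ℓ w) :
    m = n := by
  funext k
  have h1 := hm k
  have h2 := hn k
  simp only [PiLp.sub_apply, latticeVec_apply, Set.mem_Icc] at h1 h2
  have hL : 0 < L := lt_of_le_of_lt hℓ hℓL
  have hlt : |(L * (m k - n k) : ℝ)| < L := by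
    rw [abs_lt]; constructor <;> nlinarith [h1.1, h1.2, h2.1, h2.2]
  rw [abs_mul, abs_of_pos hL] at hlt
  have : |((m k - n k : ℤ) : ℝ)| < 1 := by
    have := (mul_lt_iff_lt_one_right hL).1 hlt
    exact_mod_cast this
  have hint : |m k - n k| < 1 := by exact_mod_cast this
  have h3 := abs_lt.1 hint
  omega

/-- **A periodic function integrates over a small box at most as over the cell**: for
`Lℤ³`-periodic `h ≥ 0` and `ℓ < L`, `∫_{Λ(w)} h ≤ ∫_{[0,L)³} h` (tiling of `ℝ³` by the cell; every
lattice orbit meets `Λ(w)` at most once). [folklore] -/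
theorem lintegral_slidingBox_le_cell (hℓ : 0 ≤ ℓ) (hℓL : ℓ < L) {h : Space → ℝ≥0∞}
    (hh : Measurable h) (hper : ∀ (x : Space) (m : Fin 3 → ℤ), h (x + latticeVec L m) = h x)
    (w : Space) :
    ∫⁻ x in slidingBox ℓ w, h x ≤ ∫⁻ x in cell L, h x := by
  have hL : 0 < L := lt_of_le_of_lt hℓ hℓL
  have hA := measurableSet_slidingBox ℓ w
  rw [← lintegral_indicator hA, ← tsum_lintegral_cell_sub_latticeVec hL]
  -- periodicity: `(1_Λ h)(u - Ln) = 1[u - Ln ∈ Λ] h(u)`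
  have hind : ∀ (n : Fin 3 → ℤ) (u : Space), (slidingBox ℓ w).indicator h (u - latticeVec L n) =
      ((fun u => u - latticeVec L n) ⁻¹' slidingBox ℓ w).indicator h u := by
    intro n u
    by_cases hu : u - latticeVec L n ∈ slidingBox ℓ w
    · rw [indicator_of_mem hu, indicator_of_mem (show u ∈ (fun u => u - latticeVec L n) ⁻¹'
        slidingBox ℓ w from hu)]
      have := hper (u - latticeVec L n) n
      rw [sub_add_cancel] at this
      exact this.symm
    · rw [indicator_of_notMem hu, indicator_of_notMem (show u ∉ (fun u => u - latticeVec L n) ⁻¹'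
        slidingBox ℓ w from hu)]
  simp only [hind]
  have hmeas : ∀ n : Fin 3 → ℤ, Measurable fun u =>
      ((fun u => u - latticeVec L n) ⁻¹' slidingBox ℓ w).indicator h u := fun n =>
    hh.indicator (hA.preimage (measurable_id.sub measurable_const))
  rw [← lintegral_tsum fun n => (hmeas n).aemeasurable]
  refine lintegral_mono fun u => ?_
  -- at most one lattice translate of `u` lies in the box
  by_cases hex : ∃ n : Fin 3 → ℤ, u - latticeVec L n ∈ slidingBox ℓ w
  · obtain ⟨n₀, hn₀⟩ := hex
    rw [tsum_eq_single n₀ fun n hn => ?_]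
    · exact indicator_le_self _ _ _
    · exact indicator_of_notMem (show u ∉ (fun u => u - latticeVec L n) ⁻¹' slidingBox ℓ w from
        fun hn' => hn (latticeVec_eq_of_mem_slidingBox hℓ hℓL hn' hn₀)) _
  · push Not at hex
    have h0 : ∀ n : Fin 3 → ℤ, ((fun u => u - latticeVec L n) ⁻¹' slidingBox ℓ w).indicator h u = 0 :=
      fun n => indicator_of_notMem (show u ∉ (fun u => u - latticeVec L n) ⁻¹' slidingBox ℓ w from
        hex n) _
    simp only [h0, tsum_zero, zero_le]

end Boxes

/-! ### Plane waves: multiplicativity, box averages -/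

section Waves

variable {L : ℝ}

/-- `e_n(x + y) = e_n(x) e_n(y)`. [folklore] -/
theorem cellWave_add (L : ℝ) (n : Fin 3 → ℤ) (x y : Space) :
    cellWave L n (x + y) = cellWave L n x * cellWave L n y := by
  rw [cellWave_apply, cellWave_apply, cellWave_apply, ← Complex.exp_add]
  congr 1
  simp only [PiLp.add_apply, mul_add, Finset.sum_add_distrib]
  push_cast
  ring

/-- `e_n` is continuous. [folklore] -/
theorem continuous_cellWave (L : ℝ) (n : Fin 3 → ℤ) : Continuous (cellWave L n) :=
  (contDiff_cellWave L n).continuous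

/-- `e_n` is `Lℤ³`-periodic (lattice form). [folklore] -/
theorem cellWave_add_latticeVec (hL : L ≠ 0) (n m : Fin 3 → ℤ) (x : Space) :
    cellWave L n (x + latticeVec L m) = cellWave L n x :=
  periodic_latticeVec (φ := cellWave L n) (fun x k => cellWave_periodic hL n x k) x m

end Waves

/-! ### Translation covariance of the localised objects (Λ(u) = u + Λ(0)) -/

section Covariance

variable {ℓ L : ℝ}

/-- Box integrals translate: `∫_{Λ(u)} f = ∫_{Λ(0)} f(u + ·)`. [cite: Fournais2020, (3.4)] -/
theorem setIntegral_slidingBox_eq_zero_box (ℓ : ℝ) (u : Space) (f : Space → ℂ) :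
    ∫ y in slidingBox ℓ u, f y = ∫ y in slidingBox ℓ 0, f (u + y) := by
  rw [← integral_indicator (measurableSet_slidingBox ℓ u),
    ← integral_indicator (measurableSet_slidingBox ℓ 0),
    ← integral_add_left_eq_self (μ := (volume : Measure Space)) ((slidingBox ℓ u).indicator f) u]
  congr 1
  funext y
  by_cases hy : y ∈ slidingBox ℓ 0
  · rw [indicator_of_mem hy, indicator_of_mem ((add_mem_slidingBox_iff ℓ u y).2 hy)]
  · rw [indicator_of_notMem hy, indicator_of_notMem (fun h => hy ((add_mem_slidingBox_iff ℓ u y).1 h))]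

/-- Box integrals of plane waves: `∫_{Λ(u)} e_n = e_n(u) ∫_{Λ(0)} e_n`. [cite: Fournais2020, (3.19)] -/
theorem setIntegral_slidingBox_cellWave (ℓ L : ℝ) (n : Fin 3 → ℤ) (u : Space) :
    ∫ y in slidingBox ℓ u, cellWave L n y = cellWave L n u * ∫ y in slidingBox ℓ 0, cellWave L n y := by
  rw [setIntegral_slidingBox_eq_zero_box, ← integral_const_mul]
  congr 1
  funext y
  exact cellWave_add L n u y

/-- **Covariance of `Q_u` on plane waves**: `(Q_u e_n)(x) = e_n(u) (Q_0 e_n)(x - u)`.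
[cite: Fournais2020, (3.19)] -/
theorem projQ_cellWave (ℓ L : ℝ) (n : Fin 3 → ℤ) (u x : Space) :
    projQ ℓ u (cellWave L n) x = cellWave L n u * projQ ℓ 0 (cellWave L n) (x - u) := by
  unfold projQ
  by_cases hx : x ∈ slidingBox ℓ u
  · have hx0 : x - u ∈ slidingBox ℓ 0 := (mem_slidingBox_iff_sub ℓ u x).1 hx
    rw [indicator_of_mem hx, indicator_of_mem hx0, setIntegral_slidingBox_cellWave ℓ L n u,
      show cellWave L n x = cellWave L n u * cellWave L n (x - u) by
        rw [← cellWave_add, add_sub_cancel]]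
    rw [Complex.real_smul, Complex.real_smul]
    ring
  · have hx0 : x - u ∉ slidingBox ℓ 0 := fun h => hx ((mem_slidingBox_iff_sub ℓ u x).2 h)
    rw [indicator_of_notMem hx, indicator_of_notMem hx0, mul_zero]

/-- `χ_u(x) = χ_0(x - u)`. [cite: Fournais2020, (3.6)] -/
theorem locFun_eq_zero_translate (χ : Space → ℝ) (ℓ : ℝ) (u x : Space) :
    locFun χ ℓ u x = locFun χ ℓ 0 (x - u) := by
  simp [locFun]

/-- **`Q_u` is linear** on finite linear combinations of functions integrable on the box.
[cite: Fournais2020, (3.5)] -/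
theorem projQ_finset_sum {ι : Type*} (S : Finset ι) (α : ι → ℂ) (f : ι → Space → ℂ) (ℓ : ℝ)
    (u : Space) (hf : ∀ i ∈ S, IntegrableOn (f i) (slidingBox ℓ u) volume) (x : Space) :
    projQ ℓ u (fun y => ∑ i ∈ S, α i * f i y) x = ∑ i ∈ S, α i * projQ ℓ u (f i) x := by
  unfold projQ
  by_cases hx : x ∈ slidingBox ℓ u
  · simp only [indicator_of_mem hx]
    rw [integral_finsetSum _ fun i hi => (hf i hi).const_mul (α i), Finset.smul_sum,
      ← Finset.sum_sub_distrib]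
    refine Finset.sum_congr rfl fun i hi => ?_
    rw [integral_const_mul, Complex.real_smul, Complex.real_smul]
    ring
  · simp only [indicator_of_notMem hx, mul_zero, Finset.sum_const_zero]

/-- Plane waves are integrable on boxes. [folklore] -/
theorem integrableOn_cellWave_slidingBox (ℓ L : ℝ) (n : Fin 3 → ℤ) (u : Space) :
    IntegrableOn (cellWave L n) (slidingBox ℓ u) volume := by
  refine Measure.integrableOn_of_bounded (M := 1) ?_
    (continuous_cellWave L n).aestronglyMeasurable (Eventually.of_forall fun x => ?_)
  · rw [volume_slidingBox]; exact ENNReal.pow_ne_top ENNReal.ofReal_ne_top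
  · rw [norm_cellWave]

/-- **Covariance of `χ_u Q_u` on trigonometric polynomials**:
`(χ_u Q_u P)(x) = ∑ₙ αₙ e_n(u) (χ_0 Q_0 e_n)(x - u)` for `P = ∑ₙ αₙ e_n`. [cite: Fournais2020, (3.19)] -/
theorem locProjQ_trigPoly (χ : Space → ℝ) (ℓ L : ℝ) (S : Finset (Fin 3 → ℤ)) (α : (Fin 3 → ℤ) → ℂ)
    (u x : Space) :
    (locFun χ ℓ u x : ℂ) * projQ ℓ u (fun y => ∑ n ∈ S, α n * cellWave L n y) x =
      ∑ n ∈ S, α n * cellWave L n u *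
        ((locFun χ ℓ 0 (x - u) : ℂ) * projQ ℓ 0 (cellWave L n) (x - u)) := by
  rw [projQ_finset_sum S α (fun n => cellWave L n) ℓ u
    (fun n _ => integrableOn_cellWave_slidingBox ℓ L n u) x, Finset.mul_sum]
  refine Finset.sum_congr rfl fun n _ => ?_
  rw [projQ_cellWave, locFun_eq_zero_translate χ ℓ u x]
  ring

/-- **Covariance of `Q_u` on trigonometric polynomials**:
`(Q_u P)(x) = ∑ₙ αₙ e_n(u) (Q_0 e_n)(x - u)`. [cite: Fournais2020, (3.19)] -/
theorem projQ_trigPoly (ℓ L : ℝ) (S : Finset (Fin 3 → ℤ)) (α : (Fin 3 → ℤ) → ℂ) (u x : Space) :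
    projQ ℓ u (fun y => ∑ n ∈ S, α n * cellWave L n y) x =
      ∑ n ∈ S, α n * cellWave L n u * projQ ℓ 0 (cellWave L n) (x - u) := by
  rw [projQ_finset_sum S α (fun n => cellWave L n) ℓ u
    (fun n _ => integrableOn_cellWave_slidingBox ℓ L n u) x]
  refine Finset.sum_congr rfl fun n _ => ?_
  rw [projQ_cellWave]
  ring

end Covariance

/-! ### The Fourier side: translation, linearity, integrability -/

section FourierSide

open scoped RealInnerProductSpace

variable {ℓ L : ℝ}

/-- **Translation covariance of the Fourier transform**:
`𝓕[f(· - u)](p) = 𝐞(-⟨u,p⟩) 𝓕f(p)`. [folklore] -/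
theorem fourier_comp_sub_right (f : Space → ℂ) (u p : Space) :
    𝓕 (fun x => f (x - u)) p = Real.fourierChar (-⟪u, p⟫) • 𝓕 f p := by
  rw [Real.fourier_eq, Real.fourier_eq,
    ← integral_add_right_eq_self (μ := (volume : Measure Space))
      (fun v : Space => Real.fourierChar (-⟪v, p⟫) • f (v - u)) u]
  simp only [add_sub_cancel_right]
  rw [Circle.smul_def, ← integral_smul]
  refine integral_congr_ae (Eventually.of_forall fun v => ?_)
  simp only [inner_add_left, neg_add, AddChar.map_add_eq_mul, Circle.smul_def, Circle.coe_mul,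
    smul_eq_mul]
  ring

/-- `‖𝓕[f(· - u)](p)‖ = ‖𝓕f(p)‖`. [folklore] -/
theorem norm_fourier_comp_sub_right (f : Space → ℂ) (u p : Space) :
    ‖𝓕 (fun x => f (x - u)) p‖ = ‖𝓕 f p‖ := by
  rw [fourier_comp_sub_right, Circle.norm_smul]

/-- **Linearity of the Fourier transform** on finite combinations of integrable functions.
[folklore] -/
theorem fourier_finset_sum {ι : Type*} (S : Finset ι) (c : ι → ℂ) (f : ι → Space → ℂ)
    (hf : ∀ i ∈ S, Integrable (f i)) (p : Space) :
    𝓕 (fun x => ∑ i ∈ S, c i * f i x) p = ∑ i ∈ S, c i * 𝓕 (f i) p := by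
  simp only [Real.fourier_eq]
  have hsmul : ∀ v : Space, Real.fourierChar (-⟪v, p⟫) • (∑ i ∈ S, c i * f i v) =
      ∑ i ∈ S, c i * (Real.fourierChar (-⟪v, p⟫) • f i v) := by
    intro v
    rw [Finset.smul_sum]
    refine Finset.sum_congr rfl fun i _ => ?_
    rw [Circle.smul_def, Circle.smul_def, smul_eq_mul, smul_eq_mul]
    ring
  simp only [hsmul]
  rw [integral_finsetSum _ fun i hi => ?_]
  · exact Finset.sum_congr rfl fun i _ => integral_const_mul _ _
  · exact ((Real.fourierIntegral_convergent_iff p).2 (hf i hi)).const_mul (c i)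

/-- The Fourier transform of an integrable function is continuous. [folklore] -/
theorem continuous_fourier {f : Space → ℂ} (hf : Integrable f) : Continuous (𝓕 f) :=
  VectorFourier.fourierIntegral_continuous Real.continuous_fourierChar (by exact continuous_inner) hf

/-- `|𝓕f(p) - 𝓕g(p)| ≤ ‖f - g‖₁`. [folklore] -/
theorem norm_fourier_sub_le {f g : Space → ℂ} (hf : Integrable f) (hg : Integrable g) (p : Space) :
    ‖𝓕 f p - 𝓕 g p‖ ≤ ∫ x, ‖f x - g x‖ := by
  have h : 𝓕 f p - 𝓕 g p = 𝓕 (f - g) p := by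
    have := VectorFourier.fourierIntegral_add Real.continuous_fourierChar (by exact continuous_inner)
      (e := Real.fourierChar) (μ := (volume : Measure Space)) (L := innerₗ Space) hf hg.neg
    rw [show f - g = f + -g from sub_eq_add_neg f g]
    change _ = VectorFourier.fourierIntegral Real.fourierChar volume (innerₗ Space) (f + -g) p
    rw [this, Pi.add_apply]
    change 𝓕 f p - 𝓕 g p = 𝓕 f p + 𝓕 (-g) p
    rw [sub_eq_add_neg]
    congr 1
    simp only [Real.fourier_eq, Pi.neg_apply, smul_neg, integral_neg]
  rw [h]
  exact VectorFourier.norm_fourierIntegral_le_integral_norm _ _ _ _ _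

/-- A localisation function is bounded. [cite: Fournais2020, (2.2)] -/
theorem IsLocalizationFunction.exists_bound {χ : Space → ℝ} (hχ : IsLocalizationFunction χ) :
    ∃ C, ∀ x, ‖χ x‖ ≤ C :=
  hχ.hasCompactSupport.exists_bound_of_continuous hχ.continuous

/-- `Q_u ψ` is integrable for `ψ` integrable on the box. [cite: Fournais2020, (3.5)] -/
theorem integrable_projQ (ℓ : ℝ) (u : Space) {ψ : Space → ℂ}
    (hψ : IntegrableOn ψ (slidingBox ℓ u) volume) : Integrable (projQ ℓ u ψ) := by
  unfold projQ
  rw [integrable_indicator_iff (measurableSet_slidingBox ℓ u)]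
  haveI : IsFiniteMeasure ((volume : Measure Space).restrict (slidingBox ℓ u)) :=
    ⟨by rw [Measure.restrict_apply_univ, volume_slidingBox]
        exact (ENNReal.pow_ne_top ENNReal.ofReal_ne_top).lt_top⟩
  exact hψ.sub (integrable_const _)

/-- `χ_u Q_u ψ` is integrable for `ψ` integrable on the box. [cite: Fournais2020, (3.13)] -/
theorem integrable_locProjQ {χ : Space → ℝ} (hχ : IsLocalizationFunction χ) (ℓ : ℝ) (u : Space)
    {ψ : Space → ℂ} (hψ : IntegrableOn ψ (slidingBox ℓ u) volume) :
    Integrable (fun x => (locFun χ ℓ u x : ℂ) * projQ ℓ u ψ x) := by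
  obtain ⟨C, hC⟩ := hχ.exists_bound
  refine (integrable_projQ ℓ u hψ).bdd_mul (c := C) ?_ (Eventually.of_forall fun x => ?_)
  · exact (Complex.continuous_ofReal.comp ((continuous_locFun₂ hχ ℓ).comp
      (continuous_const.prodMk continuous_id))).aestronglyMeasurable
  · rw [Complex.norm_real]
    exact hC _

/-- `Q_u ψ` is measurable for measurable `ψ`. [cite: Fournais2020, (3.5)] -/
theorem measurable_projQ (ℓ : ℝ) (u : Space) {ψ : Space → ℂ} (hψ : Measurable ψ) :
    Measurable (projQ ℓ u ψ) :=
  (hψ.sub measurable_const).indicator (measurableSet_slidingBox ℓ u)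

/-- **The Fourier side on trigonometric polynomials**:
`|𝓕(χ_uQ_uP)(p)| = |∑ₙ αₙ 𝓕(χ_0Q_0e_n)(p) e_n(u)|` for `P = ∑ₙ αₙ e_n`. [cite: Fournais2020, (3.19)] -/
theorem norm_fourier_locProjQ_trigPoly {χ : Space → ℝ} (hχ : IsLocalizationFunction χ) (ℓ L : ℝ)
    (S : Finset (Fin 3 → ℤ)) (α : (Fin 3 → ℤ) → ℂ) (u p : Space) :
    ‖𝓕 (fun x => (locFun χ ℓ u x : ℂ) * projQ ℓ u (fun y => ∑ n ∈ S, α n * cellWave L n y) x) p‖ =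
      ‖∑ n ∈ S, α n * 𝓕 (fun x => (locFun χ ℓ 0 x : ℂ) * projQ ℓ 0 (cellWave L n) x) p *
        cellWave L n u‖ := by
  have hfun : (fun x => (locFun χ ℓ u x : ℂ) * projQ ℓ u (fun y => ∑ n ∈ S, α n * cellWave L n y) x) =
      fun x => ∑ n ∈ S, (α n * cellWave L n u) *
        (fun y => (locFun χ ℓ 0 (y - u) : ℂ) * projQ ℓ 0 (cellWave L n) (y - u)) x := by
    funext x
    rw [locProjQ_trigPoly]
  rw [hfun, fourier_finset_sum S _ _ fun n _ =>
    (integrable_locProjQ hχ ℓ 0 (integrableOn_cellWave_slidingBox ℓ L n 0)).comp_sub_right u]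
  have h : ∀ n ∈ S, (α n * cellWave L n u) *
      𝓕 (fun x => (locFun χ ℓ 0 (x - u) : ℂ) * projQ ℓ 0 (cellWave L n) (x - u)) p =
      (Real.fourierChar (-⟪u, p⟫) : ℂ) * (α n *
        𝓕 (fun x => (locFun χ ℓ 0 x : ℂ) * projQ ℓ 0 (cellWave L n) x) p * cellWave L n u) := by
    intro n _
    rw [fourier_comp_sub_right (fun x => (locFun χ ℓ 0 x : ℂ) * projQ ℓ 0 (cellWave L n) x) u p,
      Circle.smul_def, smul_eq_mul]
    ring
  rw [Finset.sum_congr rfl h, ← Finset.mul_sum, norm_mul, Circle.norm_coe, one_mul]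

/-- **The `Q` side on trigonometric polynomials**:
`‖Q_uP‖² = ∫ |∑ₙ αₙ (Q_0e_n)(y) e_n(u)|² dy` for `P = ∑ₙ αₙ e_n`. [cite: Fournais2020, (3.19)] -/
theorem lintegral_projQ_trigPoly (ℓ L : ℝ) (S : Finset (Fin 3 → ℤ)) (α : (Fin 3 → ℤ) → ℂ)
    (u : Space) :
    ∫⁻ x, (‖projQ ℓ u (fun y => ∑ n ∈ S, α n * cellWave L n y) x‖₊ : ℝ≥0∞) ^ 2 =
      ∫⁻ y, (‖∑ n ∈ S, α n * projQ ℓ 0 (cellWave L n) y * cellWave L n u‖₊ : ℝ≥0∞) ^ 2 := by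
  rw [← lintegral_sub_right_eq_self (μ := (volume : Measure Space))
    (fun y => (‖∑ n ∈ S, α n * projQ ℓ 0 (cellWave L n) y * cellWave L n u‖₊ : ℝ≥0∞) ^ 2) u]
  refine lintegral_congr fun x => ?_
  rw [projQ_trigPoly]
  congr 3
  exact Finset.sum_congr rfl fun n _ => by ring

end FourierSide

/-! ### Orthogonality in `u`: `∫_Ω |∑ₙ βₙ e_n(u)|² du = L³ ∑ₙ |βₙ|²` -/

section Orthogonality

variable {L : ℝ}

/-- `e_{a+b} = e_a e_b`. [folklore] -/
theorem cellWave_add_index (L : ℝ) (a b : Fin 3 → ℤ) (x : Space) :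
    cellWave L (a + b) x = cellWave L a x * cellWave L b x := by
  unfold cellWave
  exact UnitAddTorus.mFourier_add

/-- **Plane waves with `k ≠ 0` have zero mean over the cell**: `∫_{[0,L)³} e_k = 0`
(`e_k = (L/2πikⱼ) ∂ⱼe_k` for a `j` with `kⱼ ≠ 0`, and periodic integration by parts). [folklore] -/
theorem integral_cell_cellWave_eq_zero (hL : 0 < L) {k : Fin 3 → ℤ} (hk : k ≠ 0) :
    ∫ x in cell L, cellWave L k x = 0 := by
  obtain ⟨j, hj⟩ := Function.ne_iff.1 hk
  have hc : (2 * Real.pi * Complex.I * (k j) / L : ℂ) ≠ 0 := by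
    have h1 : (k j : ℂ) ≠ 0 := by exact_mod_cast hj
    have h2 : (L : ℂ) ≠ 0 := by exact_mod_cast hL.ne'
    have h3 : (Real.pi : ℂ) ≠ 0 := by exact_mod_cast Real.pi_ne_zero
    field_simp
    simp [h1, h3, Complex.I_ne_zero, hL.ne']
  have hIBP := integral_cell_fderiv_eq_zero hL ((contDiff_cellWave L k).of_le (mod_cast le_top))
    (fun x i => cellWave_periodic hL.ne' k x i) j
  simp only [fderiv_cellWave_apply_single, integral_const_mul, mul_eq_zero, hc, false_or] at hIBP
  exact hIBP

/-- `∫_{[0,L)³} e_0 = L³`. [folklore] -/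
theorem integral_cell_cellWave_zero (hL : 0 < L) : ∫ x in cell L, cellWave L 0 x = (L : ℂ) ^ 3 := by
  simp only [cellWave_zero]
  rw [setIntegral_const, Measure.real, volume_cell, ← ENNReal.ofReal_pow hL.le,
    ENNReal.toReal_ofReal (by positivity)]
  simp

/-- The Fourier coefficients of a plane wave: `ĉₘ(e_n) = δₘₙ`. [folklore] -/
theorem cellFourierCoeff_cellWave (hL : 0 < L) (n m : Fin 3 → ℤ) :
    cellFourierCoeff L (cellWave L n) m = if m = n then 1 else 0 := by
  rw [cellFourierCoeff_eq_integral hL]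
  simp only [conj_cellWave, ← cellWave_add_index]
  by_cases hmn : m = n
  · subst hmn
    rw [if_pos rfl, neg_add_cancel, integral_cell_cellWave_zero hL, Complex.real_smul]
    have h2 : (L : ℂ) ≠ 0 := by exact_mod_cast hL.ne'
    push_cast
    field_simp
  · rw [if_neg hmn, integral_cell_cellWave_eq_zero hL (fun h => hmn ?_), smul_zero]
    have := congrArg (· + m) h
    simpa using this.symm

/-- **Linearity of the cell Fourier coefficients** on trigonometric polynomials:
`ĉₘ(∑ₙ βₙ e_n) = βₘ` (`m` in the index set) or `0`. [folklore] -/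
theorem cellFourierCoeff_trigPoly (hL : 0 < L) (S : Finset (Fin 3 → ℤ)) (β : (Fin 3 → ℤ) → ℂ)
    (m : Fin 3 → ℤ) :
    cellFourierCoeff L (fun u => ∑ n ∈ S, β n * cellWave L n u) m = if m ∈ S then β m else 0 := by
  classical
  rw [cellFourierCoeff_eq_integral hL]
  have hint : ∀ n ∈ S, Integrable (fun u => conj (cellWave L m u) * (β n * cellWave L n u))
      (volume.restrict (cell L)) := fun n _ =>
    integrableOn_cell (((continuous_cellWave L m).star).mul
      (continuous_const.mul (continuous_cellWave L n)))
  simp only [Finset.mul_sum]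
  rw [integral_finsetSum _ hint, Finset.smul_sum]
  have hterm : ∀ n ∈ S, ((L ^ 3)⁻¹ : ℝ) • ∫ u in cell L, conj (cellWave L m u) * (β n * cellWave L n u) =
      β n * cellFourierCoeff L (cellWave L n) m := by
    intro n _
    rw [cellFourierCoeff_eq_integral hL,
      show (∫ u in cell L, conj (cellWave L m u) * (β n * cellWave L n u)) =
        β n * ∫ u in cell L, conj (cellWave L m u) * cellWave L n u by
          rw [← integral_const_mul]; congr 1; funext u; ring,
      mul_smul_comm]
  rw [Finset.sum_congr rfl hterm]
  simp only [cellFourierCoeff_cellWave hL, mul_ite, mul_one, mul_zero]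
  rw [Finset.sum_ite_eq]

/-- **Finite Parseval / orthogonality of the plane waves in `u`**:
`∫_{[0,L)³} ‖∑ₙ βₙ e_n(u)‖² du = L³ ∑ₙ ‖βₙ‖²`. [cite: Fournais2020, (3.19)] -/
theorem lintegral_cell_normSq_trigPoly (hL : 0 < L) (S : Finset (Fin 3 → ℤ)) (β : (Fin 3 → ℤ) → ℂ) :
    ∫⁻ u in cell L, (‖∑ n ∈ S, β n * cellWave L n u‖₊ : ℝ≥0∞) ^ 2 =
      ENNReal.ofReal L ^ 3 * ∑ n ∈ S, (‖β n‖₊ : ℝ≥0∞) ^ 2 := by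
  classical
  have hcont : Continuous fun u => ∑ n ∈ S, β n * cellWave L n u :=
    continuous_finsetSum _ fun n _ => continuous_const.mul (continuous_cellWave L n)
  have hP := tsum_sq_cellFourierCoeff hL hcont
  simp only [cellFourierCoeff_trigPoly hL] at hP
  rw [tsum_eq_sum (s := S) (fun m hm => by simp [hm])] at hP
  have hsum : ∑ m ∈ S, ((‖(if m ∈ S then β m else 0)‖₊ : ℝ≥0∞) ^ 2) = ∑ n ∈ S, (‖β n‖₊ : ℝ≥0∞) ^ 2 :=
    Finset.sum_congr rfl fun m hm => by simp [hm]
  rw [hsum] at hP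
  have hL3 : (ENNReal.ofReal L ^ 3) ≠ 0 := pow_ne_zero _ (by simpa using hL)
  have hL3' : (ENNReal.ofReal L ^ 3) ≠ ⊤ := ENNReal.pow_ne_top ENNReal.ofReal_ne_top
  rw [hP, ← mul_assoc, ENNReal.mul_inv_cancel hL3 hL3', one_mul]

end Orthogonality

/-! ### (3.19)–(3.20): the `u`-average of `⟨P, T_u P⟩` for trigonometric polynomials -/

section Diagonal

variable {ℓ L : ℝ}

/-- Equal norms give equal `ℝ≥0∞`-squared norms. [folklore] -/
theorem coe_nnnorm_sq_congr {z w : ℂ} (h : ‖z‖ = ‖w‖) :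
    ((‖z‖₊ : ℝ≥0∞) ^ 2) = (‖w‖₊ : ℝ≥0∞) ^ 2 := by
  rw [coe_nnnorm_sq_eq_ofReal, coe_nnnorm_sq_eq_ofReal, h]

/-- The multiplier `τ(p) = (4π²|p|² - (sℓ)⁻²)₊` is measurable. [cite: Fournais2020, (3.18)] -/
theorem measurable_tau (s ℓ : ℝ) :
    Measurable fun p : Space => ENNReal.ofReal (4 * Real.pi ^ 2 * ‖p‖ ^ 2 - (s * ℓ)⁻¹ ^ 2) :=
  ENNReal.measurable_ofReal.comp (by fun_prop)

/-- Measurability of `(u, z) ↦ ‖∑ₙ αₙ fₙ(z) e_n(u)‖₊²` for measurable `fₙ`. [folklore] -/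
theorem measurable_normSq_trigPoly₂ (L : ℝ) (S : Finset (Fin 3 → ℤ)) (α : (Fin 3 → ℤ) → ℂ)
    {f : (Fin 3 → ℤ) → Space → ℂ} (hf : ∀ n, Measurable (f n)) :
    Measurable fun z : Space × Space =>
      (‖∑ n ∈ S, α n * f n z.2 * cellWave L n z.1‖₊ : ℝ≥0∞) ^ 2 := by
  refine (Measurable.nnnorm ?_).coe_nnreal_ennreal.pow_const _
  refine Finset.measurable_sum _ fun n _ => ?_
  exact ((measurable_const.mul ((hf n).comp measurable_snd)).mul
    ((continuous_cellWave L n).measurable.comp measurable_fst))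

/-- The `u`-integral of `‖∑ₙ αₙ fₙ(z) e_n(u)‖₊²` over the cell, for fixed `z`:
`L³ ∑ₙ ‖αₙ‖₊² ‖fₙ(z)‖₊²`. [cite: Fournais2020, (3.19)] -/
theorem lintegral_cell_normSq_trigPoly_mul (hL : 0 < L) (S : Finset (Fin 3 → ℤ))
    (α : (Fin 3 → ℤ) → ℂ) (f : (Fin 3 → ℤ) → Space → ℂ) (z : Space) :
    ∫⁻ u in cell L, (‖∑ n ∈ S, α n * f n z * cellWave L n u‖₊ : ℝ≥0∞) ^ 2 =
      ENNReal.ofReal L ^ 3 * ∑ n ∈ S, (‖α n‖₊ : ℝ≥0∞) ^ 2 * (‖f n z‖₊ : ℝ≥0∞) ^ 2 := by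
  rw [lintegral_cell_normSq_trigPoly hL S (fun n => α n * f n z)]
  congr 1
  refine Finset.sum_congr rfl fun n _ => ?_
  rw [nnnorm_mul, ENNReal.coe_mul, mul_pow]

/-- The Fourier side of `⟨P, T_uP⟩` for a trigonometric polynomial, pointwise in `u`:
`∫ τ |𝓕(χ_uQ_uP)|² = ∫ τ(p) |∑ₙ αₙ 𝓕(χ_0Q_0e_n)(p) e_n(u)|² dp`. [cite: Fournais2020, (3.19)] -/
theorem fourierPart_trigPoly {χ : Space → ℝ} (hχ : IsLocalizationFunction χ) (ℓ L s : ℝ)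
    (S : Finset (Fin 3 → ℤ)) (α : (Fin 3 → ℤ) → ℂ) (u : Space) :
    ∫⁻ p, ENNReal.ofReal (4 * Real.pi ^ 2 * ‖p‖ ^ 2 - (s * ℓ)⁻¹ ^ 2) *
        (‖𝓕 (fun x => (locFun χ ℓ u x : ℂ) * projQ ℓ u (fun y => ∑ n ∈ S, α n * cellWave L n y) x) p‖₊ :
          ℝ≥0∞) ^ 2 =
      ∫⁻ p, ENNReal.ofReal (4 * Real.pi ^ 2 * ‖p‖ ^ 2 - (s * ℓ)⁻¹ ^ 2) *
        (‖∑ n ∈ S, α n * 𝓕 (fun x => (locFun χ ℓ 0 x : ℂ) * projQ ℓ 0 (cellWave L n) x) p *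
          cellWave L n u‖₊ : ℝ≥0∞) ^ 2 :=
  lintegral_congr fun p => by rw [coe_nnnorm_sq_congr (norm_fourier_locProjQ_trigPoly hχ ℓ L S α u p)]

/-- Measurability in `u` of the Fourier side of `⟨P, T_uP⟩` for a trigonometric polynomial `P`.
[cite: Fournais2020, (3.19)] -/
theorem measurable_fourierPart_trigPoly {χ : Space → ℝ} (hχ : IsLocalizationFunction χ) (ℓ L s : ℝ)
    (S : Finset (Fin 3 → ℤ)) (α : (Fin 3 → ℤ) → ℂ) :
    Measurable fun u : Space => ∫⁻ p, ENNReal.ofReal (4 * Real.pi ^ 2 * ‖p‖ ^ 2 - (s * ℓ)⁻¹ ^ 2) *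
      (‖𝓕 (fun x => (locFun χ ℓ u x : ℂ) * projQ ℓ u (fun y => ∑ n ∈ S, α n * cellWave L n y) x) p‖₊ :
        ℝ≥0∞) ^ 2 := by
  simp only [fourierPart_trigPoly hχ]
  have ha_cont : ∀ n : Fin 3 → ℤ, Continuous
      (𝓕 (fun x => (locFun χ ℓ 0 x : ℂ) * projQ ℓ 0 (cellWave L n) x)) := fun n =>
    continuous_fourier (integrable_locProjQ hχ ℓ 0 (integrableOn_cellWave_slidingBox ℓ L n 0))
  exact (((measurable_tau s ℓ).comp measurable_snd).mul (measurable_normSq_trigPoly₂ L S α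
    fun n => (ha_cont n).measurable)).lintegral_prod_right

/-- Measurability in `u` of the `Q` side of `⟨P, T_uP⟩` for a trigonometric polynomial `P`.
[cite: Fournais2020, (3.19)] -/
theorem measurable_projQPart_trigPoly (ℓ L : ℝ) (S : Finset (Fin 3 → ℤ)) (α : (Fin 3 → ℤ) → ℂ) :
    Measurable fun u : Space =>
      ∫⁻ x, (‖projQ ℓ u (fun y => ∑ n ∈ S, α n * cellWave L n y) x‖₊ : ℝ≥0∞) ^ 2 := by
  simp only [lintegral_projQ_trigPoly]
  exact (measurable_normSq_trigPoly₂ L S α fun n =>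
    measurable_projQ ℓ 0 (continuous_cellWave L n).measurable).lintegral_prod_right

/-- **(3.19), Fourier side**: `∫_Ω ∫τ|𝓕(χ_uQ_uP)|² du = L³∑ₙ|αₙ|² ∫τ|𝓕(χ_0Q_0e_n)|²`.
[cite: Fournais2020, (3.19)–(3.20)] -/
theorem lintegral_cell_fourierPart_trigPoly {χ : Space → ℝ} (hχ : IsLocalizationFunction χ)
    (hL : 0 < L) (ℓ s : ℝ) (S : Finset (Fin 3 → ℤ)) (α : (Fin 3 → ℤ) → ℂ) :
    ∫⁻ u in cell L, ∫⁻ p, ENNReal.ofReal (4 * Real.pi ^ 2 * ‖p‖ ^ 2 - (s * ℓ)⁻¹ ^ 2) *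
        (‖𝓕 (fun x => (locFun χ ℓ u x : ℂ) * projQ ℓ u (fun y => ∑ n ∈ S, α n * cellWave L n y) x) p‖₊ :
          ℝ≥0∞) ^ 2 =
      ENNReal.ofReal L ^ 3 * ∑ n ∈ S, (‖α n‖₊ : ℝ≥0∞) ^ 2 *
        ∫⁻ p, ENNReal.ofReal (4 * Real.pi ^ 2 * ‖p‖ ^ 2 - (s * ℓ)⁻¹ ^ 2) *
          (‖𝓕 (fun x => (locFun χ ℓ 0 x : ℂ) * projQ ℓ 0 (cellWave L n) x) p‖₊ : ℝ≥0∞) ^ 2 := by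
  set a : (Fin 3 → ℤ) → Space → ℂ := fun n =>
    𝓕 (fun x => (locFun χ ℓ 0 x : ℂ) * projQ ℓ 0 (cellWave L n) x) with ha
  set τ : Space → ℝ≥0∞ := fun p => ENNReal.ofReal (4 * Real.pi ^ 2 * ‖p‖ ^ 2 - (s * ℓ)⁻¹ ^ 2) with hτ
  have ha_cont : ∀ n, Continuous (a n) := fun n =>
    continuous_fourier (integrable_locProjQ hχ ℓ 0 (integrableOn_cellWave_slidingBox ℓ L n 0))
  have hτm : Measurable τ := measurable_tau s ℓ
  simp only [fourierPart_trigPoly hχ]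
  have hF₁ : Measurable (Function.uncurry fun (u p : Space) =>
      τ p * (‖∑ n ∈ S, α n * a n p * cellWave L n u‖₊ : ℝ≥0∞) ^ 2) :=
    (hτm.comp measurable_snd).mul (measurable_normSq_trigPoly₂ L S α fun n => (ha_cont n).measurable)
  have hT₁ : ∫⁻ u in cell L, ∫⁻ p, τ p * (‖∑ n ∈ S, α n * a n p * cellWave L n u‖₊ : ℝ≥0∞) ^ 2 =
      ∫⁻ p, ∫⁻ u in cell L, τ p * (‖∑ n ∈ S, α n * a n p * cellWave L n u‖₊ : ℝ≥0∞) ^ 2 :=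
    lintegral_lintegral_swap hF₁.aemeasurable
  have h1 : ∀ p : Space, ∫⁻ u in cell L, τ p * (‖∑ n ∈ S, α n * a n p * cellWave L n u‖₊ : ℝ≥0∞) ^ 2 =
      ENNReal.ofReal L ^ 3 * ∑ n ∈ S, (‖α n‖₊ : ℝ≥0∞) ^ 2 * (τ p * (‖a n p‖₊ : ℝ≥0∞) ^ 2) := by
    intro p
    have hmu : Measurable fun u : Space =>
        (‖∑ n ∈ S, α n * a n p * cellWave L n u‖₊ : ℝ≥0∞) ^ 2 :=
      ((continuous_finsetSum _ fun n _ =>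
        continuous_const.mul (continuous_cellWave L n)).measurable.nnnorm.coe_nnreal_ennreal).pow_const _
    rw [lintegral_const_mul _ hmu, lintegral_cell_normSq_trigPoly_mul hL, Finset.mul_sum,
      Finset.mul_sum, Finset.mul_sum]
    exact Finset.sum_congr rfl fun n _ => by ring
  have hm1 : ∀ n : Fin 3 → ℤ, Measurable fun p => τ p * (‖a n p‖₊ : ℝ≥0∞) ^ 2 := fun n =>
    hτm.mul ((ha_cont n).measurable.nnnorm.coe_nnreal_ennreal.pow_const _)
  rw [hT₁]
  simp only [h1]
  rw [lintegral_const_mul _ (Finset.measurable_sum _ fun n _ => (hm1 n).const_mul _),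
    lintegral_finsetSum _ fun n _ => (hm1 n).const_mul _]
  simp only [lintegral_const_mul _ (hm1 _)]
  rfl

/-- **(3.19), `Q` side**: `∫_Ω ‖Q_uP‖² du = L³∑ₙ|αₙ|² ‖Q_0e_n‖²`. [cite: Fournais2020, (3.19)–(3.20)] -/
theorem lintegral_cell_projQPart_trigPoly (hL : 0 < L) (ℓ : ℝ) (S : Finset (Fin 3 → ℤ))
    (α : (Fin 3 → ℤ) → ℂ) :
    ∫⁻ u in cell L, ∫⁻ x, (‖projQ ℓ u (fun y => ∑ n ∈ S, α n * cellWave L n y) x‖₊ : ℝ≥0∞) ^ 2 =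
      ENNReal.ofReal L ^ 3 * ∑ n ∈ S, (‖α n‖₊ : ℝ≥0∞) ^ 2 *
        ∫⁻ x, (‖projQ ℓ 0 (cellWave L n) x‖₊ : ℝ≥0∞) ^ 2 := by
  set q : (Fin 3 → ℤ) → Space → ℂ := fun n => projQ ℓ 0 (cellWave L n) with hq
  have hq_meas : ∀ n, Measurable (q n) := fun n =>
    measurable_projQ ℓ 0 (continuous_cellWave L n).measurable
  simp only [lintegral_projQ_trigPoly]
  have hF₂ : Measurable (Function.uncurry fun (u y : Space) =>
      (‖∑ n ∈ S, α n * q n y * cellWave L n u‖₊ : ℝ≥0∞) ^ 2) :=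
    measurable_normSq_trigPoly₂ L S α hq_meas
  have hT₂ : ∫⁻ u in cell L, ∫⁻ y, (‖∑ n ∈ S, α n * q n y * cellWave L n u‖₊ : ℝ≥0∞) ^ 2 =
      ∫⁻ y, ∫⁻ u in cell L, (‖∑ n ∈ S, α n * q n y * cellWave L n u‖₊ : ℝ≥0∞) ^ 2 :=
    lintegral_lintegral_swap hF₂.aemeasurable
  have h2 : ∀ y : Space, ∫⁻ u in cell L, (‖∑ n ∈ S, α n * q n y * cellWave L n u‖₊ : ℝ≥0∞) ^ 2 =
      ENNReal.ofReal L ^ 3 * ∑ n ∈ S, (‖α n‖₊ : ℝ≥0∞) ^ 2 * (‖q n y‖₊ : ℝ≥0∞) ^ 2 := fun y =>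
    lintegral_cell_normSq_trigPoly_mul hL S α q y
  have hm2 : ∀ n : Fin 3 → ℤ, Measurable fun y => (‖q n y‖₊ : ℝ≥0∞) ^ 2 := fun n =>
    (hq_meas n).nnnorm.coe_nnreal_ennreal.pow_const _
  rw [hT₂]
  simp only [h2]
  rw [lintegral_const_mul _ (Finset.measurable_sum _ fun n _ => (hm2 n).const_mul _),
    lintegral_finsetSum _ fun n _ => (hm2 n).const_mul _]
  simp only [lintegral_const_mul _ (hm2 _)]
  rfl

/-- **Fournais 2020, (3.19)–(3.20)** for trigonometric polynomials `P = ∑ₙ αₙ e_n`: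
`∫_Ω ⟨P, T_u P⟩ du = L³ ∑ₙ |αₙ|² ⟨e_n, T_0 e_n⟩` (`= L³ℓ³∑ₙ|αₙ|²F(n)`): the `u`-averaged localised
kinetic energy is diagonal in the plane waves. [cite: Fournais2020, (3.19)–(3.20)] -/
theorem lintegral_cell_kinLoc_trigPoly {χ : Space → ℝ} (hχ : IsLocalizationFunction χ) (hL : 0 < L)
    (ℓ s b : ℝ) (S : Finset (Fin 3 → ℤ)) (α : (Fin 3 → ℤ) → ℂ) :
    ∫⁻ u in cell L, kinLoc χ ℓ s b u (fun x => ∑ n ∈ S, α n * cellWave L n x) =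
      ENNReal.ofReal L ^ 3 * ∑ n ∈ S, (‖α n‖₊ : ℝ≥0∞) ^ 2 * kinLoc χ ℓ s b 0 (cellWave L n) := by
  unfold kinLoc
  rw [lintegral_add_left (measurable_fourierPart_trigPoly hχ ℓ L s S α),
    lintegral_const_mul _ (measurable_projQPart_trigPoly ℓ L S α),
    lintegral_cell_fourierPart_trigPoly hχ hL, lintegral_cell_projQPart_trigPoly hL]
  simp only [Finset.mul_sum, mul_add, Finset.sum_add_distrib]
  congr 1
  refine Finset.sum_congr rfl (fun n _ => ?_)
  ring

end Diagonal

/-! ### `Q_u` is a contraction in `L²`; the `L¹` bound for `χ_uQ_u` -/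

section Contraction

variable {ℓ L : ℝ}

/-- The box `Λ(u)` is compact. [cite: Fournais2020, (3.4)] -/
theorem isCompact_slidingBox (ℓ : ℝ) (u : Space) : IsCompact (slidingBox ℓ u) := by
  have h : slidingBox ℓ u = (toLp 2 '' Set.univ.pi fun k => Icc (u k + -ℓ / 2) (u k + ℓ / 2) : Set Space) := by
    ext x
    simp only [slidingBox, Set.mem_Icc, Set.mem_setOf_eq, Set.mem_image, Set.mem_pi, Set.mem_univ,
      forall_const]
    constructor
    · intro hx
      refine ⟨ofLp x, fun k => ?_, rfl⟩
      have := hx k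
      constructor <;> linarith [this.1, this.2]
    · rintro ⟨y, hy, rfl⟩ k
      have := hy k
      constructor <;> linarith [this.1, this.2]
  rw [h]
  exact (isCompact_univ_pi fun _ => isCompact_Icc).image (PiLp.continuous_toLp 2 _)

/-- A continuous function is integrable on the box. [folklore] -/
theorem integrableOn_slidingBox {E : Type*} [NormedAddCommGroup E] {f : Space → E} (hf : Continuous f)
    (ℓ : ℝ) (u : Space) : IntegrableOn f (slidingBox ℓ u) volume :=
  hf.continuousOn.integrableOn_compact (isCompact_slidingBox ℓ u)

/-- `∫⁻_Λ ‖f‖₊² = ofReal (∫_Λ ‖f‖²)` for continuous `f`. [folklore] -/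
theorem lintegral_slidingBox_nnnorm_sq_eq_ofReal {f : Space → ℂ} (hf : Continuous f) (ℓ : ℝ) (u : Space) :
    ∫⁻ x in slidingBox ℓ u, (‖f x‖₊ : ℝ≥0∞) ^ 2 =
      ENNReal.ofReal (∫ x in slidingBox ℓ u, ‖f x‖ ^ 2) := by
  simp only [coe_nnnorm_sq_eq_ofReal]
  rw [ofReal_integral_eq_lintegral_ofReal
    (integrableOn_slidingBox (f := fun x => ‖f x‖ ^ 2) (hf.norm.pow 2) ℓ u)
    (Eventually.of_forall fun x => by positivity)]

/-- **`Q_u` is a contraction**: `‖Q_u h‖² = ∫_{Λ(u)}|h - ⟨h⟩|² = ∫_{Λ(u)}|h|² - ℓ³|⟨h⟩|² ≤ ∫_{Λ(u)}|h|²`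
(the box average is the orthogonal projection onto the constants). [cite: Fournais2020, (3.5)] -/
theorem lintegral_nnnorm_sq_projQ_le (hℓ : 0 < ℓ) (u : Space) {h : Space → ℂ} (hh : Continuous h) :
    ∫⁻ x, (‖projQ ℓ u h x‖₊ : ℝ≥0∞) ^ 2 ≤ ∫⁻ x in slidingBox ℓ u, (‖h x‖₊ : ℝ≥0∞) ^ 2 := by
  set m : ℂ := ((ℓ ^ 3)⁻¹ : ℝ) • ∫ y in slidingBox ℓ u, h y with hm
  have hA := measurableSet_slidingBox ℓ u
  -- `‖Q_u h‖² = ∫_Λ ‖h - m‖²`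
  have h1 : ∫⁻ x, (‖projQ ℓ u h x‖₊ : ℝ≥0∞) ^ 2 =
      ∫⁻ x in slidingBox ℓ u, (‖h x - m‖₊ : ℝ≥0∞) ^ 2 := by
    rw [← lintegral_indicator hA]
    refine lintegral_congr fun x => ?_
    unfold projQ
    by_cases hx : x ∈ slidingBox ℓ u
    · rw [indicator_of_mem hx, indicator_of_mem hx]
    · rw [indicator_of_notMem hx, indicator_of_notMem hx]; simp
  rw [h1, lintegral_slidingBox_nnnorm_sq_eq_ofReal (f := fun x => h x - m) (hh.sub continuous_const),
    lintegral_slidingBox_nnnorm_sq_eq_ofReal hh]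
  refine ENNReal.ofReal_le_ofReal ?_
  -- the real computation `∫_Λ ‖h - m‖² = ∫_Λ ‖h‖² - ℓ³‖m‖²`
  have hvol : (volume (slidingBox ℓ u)).toReal = ℓ ^ 3 := by
    rw [volume_slidingBox, ← ENNReal.ofReal_pow hℓ.le, ENNReal.toReal_ofReal (by positivity)]
  have hint_h : IntegrableOn h (slidingBox ℓ u) volume := integrableOn_slidingBox hh ℓ u
  have hIh : ∫ y in slidingBox ℓ u, h y = (ℓ ^ 3 : ℝ) • m := by
    rw [hm, ← smul_assoc, smul_eq_mul, mul_inv_cancel₀ (by positivity), one_smul]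
  have hpt : ∀ x, ‖h x - m‖ ^ 2 = ‖h x‖ ^ 2 + ‖m‖ ^ 2 - 2 * (h x * conj m).re := by
    intro x
    rw [Complex.sq_norm, Complex.sq_norm, Complex.sq_norm, Complex.normSq_sub]
  simp only [hpt]
  have hi1 : IntegrableOn (fun x => ‖h x‖ ^ 2) (slidingBox ℓ u) volume :=
    integrableOn_slidingBox (hh.norm.pow 2) ℓ u
  have hi2 : IntegrableOn (fun _ : Space => ‖m‖ ^ 2) (slidingBox ℓ u) volume :=
    integrableOn_slidingBox continuous_const ℓ u
  have hi3 : IntegrableOn (fun x => 2 * (h x * conj m).re) (slidingBox ℓ u) volume :=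
    integrableOn_slidingBox (continuous_const.mul (Complex.continuous_re.comp
      (hh.mul continuous_const))) ℓ u
  have hi12 : IntegrableOn (fun x => ‖h x‖ ^ 2 + ‖m‖ ^ 2) (slidingBox ℓ u) volume := hi1.add hi2
  have hsplit : ∫ x in slidingBox ℓ u, (‖h x‖ ^ 2 + ‖m‖ ^ 2 - 2 * (h x * conj m).re) =
      (∫ x in slidingBox ℓ u, ‖h x‖ ^ 2) + (∫ x in slidingBox ℓ u, (fun _ => ‖m‖ ^ 2) x) -
        2 * ∫ x in slidingBox ℓ u, (h x * conj m).re := by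
    rw [integral_sub hi12 hi3, integral_add hi1 hi2, integral_const_mul]
  rw [hsplit, setIntegral_const, Measure.real, hvol]
  have hre : ∫ x in slidingBox ℓ u, (h x * conj m).re = ℓ ^ 3 * ‖m‖ ^ 2 := by
    have := integral_re ((hint_h.mul_const (conj m)))
    simp only [RCLike.re_to_complex] at this
    rw [this, integral_mul_const, hIh, Complex.real_smul, mul_assoc, Complex.mul_conj,
      Complex.normSq_eq_norm_sq]
    norm_cast
  rw [hre, smul_eq_mul]
  nlinarith [sq_nonneg ‖m‖, pow_pos hℓ 3]

/-- Cauchy–Schwarz on a box: `∫ ‖f‖ 1_Λ ≤ |Λ|^{1/2} (∫ ‖f‖²)^{1/2}` for `f` vanishing off `Λ(u)`.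
[folklore] -/
theorem lintegral_enorm_le_sqrt_vol_mul (ℓ : ℝ) (u : Space) {f : Space → ℂ} (hf : Measurable f)
    (hsupp : ∀ x ∉ slidingBox ℓ u, f x = 0) :
    ∫⁻ x, ‖f x‖ₑ ≤ (ENNReal.ofReal ℓ ^ 3) ^ (1 / 2 : ℝ) * (∫⁻ x, (‖f x‖₊ : ℝ≥0∞) ^ 2) ^ (1 / 2 : ℝ) := by
  have hA := measurableSet_slidingBox ℓ u
  have hind : ∀ x, ‖f x‖ₑ = ((slidingBox ℓ u).indicator (fun _ => (1 : ℝ≥0∞)) * fun x => ‖f x‖ₑ) x := by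
    intro x
    by_cases hx : x ∈ slidingBox ℓ u
    · simp [indicator_of_mem hx]
    · simp [indicator_of_notMem hx, hsupp x hx]
  calc ∫⁻ x, ‖f x‖ₑ = ∫⁻ x, ((slidingBox ℓ u).indicator (fun _ => (1 : ℝ≥0∞)) * fun x => ‖f x‖ₑ) x :=
        lintegral_congr hind
    _ ≤ (∫⁻ x, (slidingBox ℓ u).indicator (fun _ => (1 : ℝ≥0∞)) x ^ (2 : ℝ)) ^ (1 / (2 : ℝ)) *
          (∫⁻ x, ‖f x‖ₑ ^ (2 : ℝ)) ^ (1 / (2 : ℝ)) :=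
        ENNReal.lintegral_mul_le_Lp_mul_Lq volume Real.HolderConjugate.two_two
          ((measurable_const.indicator hA).aemeasurable) hf.enorm.aemeasurable
    _ = (ENNReal.ofReal ℓ ^ 3) ^ (1 / 2 : ℝ) * (∫⁻ x, (‖f x‖₊ : ℝ≥0∞) ^ 2) ^ (1 / 2 : ℝ) := by
        congr 2
        · rw [← volume_slidingBox ℓ u, ← lintegral_indicator_one hA]
          refine lintegral_congr fun x => ?_
          by_cases hx : x ∈ slidingBox ℓ u
          · simp [indicator_of_mem hx]
          · simp [indicator_of_notMem hx]
        · refine lintegral_congr fun x => ?_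
          rw [ENNReal.rpow_two, enorm_eq_nnnorm]

/-- `Q_u` is additive on continuous functions. [cite: Fournais2020, (3.5)] -/
theorem projQ_sub {ψ₁ ψ₂ : Space → ℂ} (h₁ : Continuous ψ₁) (h₂ : Continuous ψ₂) (ℓ : ℝ) (u x : Space) :
    projQ ℓ u ψ₁ x - projQ ℓ u ψ₂ x = projQ ℓ u (fun y => ψ₁ y - ψ₂ y) x := by
  unfold projQ
  by_cases hx : x ∈ slidingBox ℓ u
  · simp only [indicator_of_mem hx]
    rw [integral_sub (integrableOn_slidingBox h₁ ℓ u) (integrableOn_slidingBox h₂ ℓ u), smul_sub]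
    ring
  · simp only [indicator_of_notMem hx, sub_zero]

/-- **The `L¹` bound for the localised functions**: for continuous `ψ₁, ψ₂`,
`‖χ_uQ_uψ₁ - χ_uQ_uψ₂‖₁ ≤ C |Λ|^{1/2} ‖ψ₁ - ψ₂‖_{L²(Λ(u))}` (`|χ| ≤ C`, `Q_u` a contraction).
[cite: Fournais2020, (3.13)] -/
theorem lintegral_enorm_locProjQ_sub_le {χ : Space → ℝ} {C : ℝ}
    (hC : ∀ x, ‖χ x‖ ≤ C) (hℓ : 0 < ℓ) (u : Space) {ψ₁ ψ₂ : Space → ℂ} (h₁ : Continuous ψ₁)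
    (h₂ : Continuous ψ₂) :
    ∫⁻ x, ‖(locFun χ ℓ u x : ℂ) * projQ ℓ u ψ₁ x - (locFun χ ℓ u x : ℂ) * projQ ℓ u ψ₂ x‖ₑ ≤
      ENNReal.ofReal C * ((ENNReal.ofReal ℓ ^ 3) ^ (1 / 2 : ℝ) *
        (∫⁻ x in slidingBox ℓ u, (‖ψ₁ x - ψ₂ x‖₊ : ℝ≥0∞) ^ 2) ^ (1 / 2 : ℝ)) := by
  have hd : Continuous fun y => ψ₁ y - ψ₂ y := h₁.sub h₂
  have hpt : ∀ x, ‖(locFun χ ℓ u x : ℂ) * projQ ℓ u ψ₁ x - (locFun χ ℓ u x : ℂ) * projQ ℓ u ψ₂ x‖ₑ ≤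
      ENNReal.ofReal C * ‖projQ ℓ u (fun y => ψ₁ y - ψ₂ y) x‖ₑ := by
    intro x
    rw [← mul_sub, projQ_sub h₁ h₂, enorm_mul, ← ofReal_norm, Complex.norm_real]
    gcongr
    exact hC _
  calc ∫⁻ x, ‖(locFun χ ℓ u x : ℂ) * projQ ℓ u ψ₁ x - (locFun χ ℓ u x : ℂ) * projQ ℓ u ψ₂ x‖ₑ
      ≤ ∫⁻ x, ENNReal.ofReal C * ‖projQ ℓ u (fun y => ψ₁ y - ψ₂ y) x‖ₑ := lintegral_mono hpt
    _ = ENNReal.ofReal C * ∫⁻ x, ‖projQ ℓ u (fun y => ψ₁ y - ψ₂ y) x‖ₑ := by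
        rw [lintegral_const_mul _ (measurable_projQ ℓ u hd.measurable).enorm]
    _ ≤ ENNReal.ofReal C * ((ENNReal.ofReal ℓ ^ 3) ^ (1 / 2 : ℝ) *
          (∫⁻ x, (‖projQ ℓ u (fun y => ψ₁ y - ψ₂ y) x‖₊ : ℝ≥0∞) ^ 2) ^ (1 / 2 : ℝ)) := by
        gcongr
        exact lintegral_enorm_le_sqrt_vol_mul ℓ u (measurable_projQ ℓ u hd.measurable)
          fun x hx => projQ_eq_zero_of_not_mem _ hx
    _ ≤ ENNReal.ofReal C * ((ENNReal.ofReal ℓ ^ 3) ^ (1 / 2 : ℝ) *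
          (∫⁻ x in slidingBox ℓ u, (‖ψ₁ x - ψ₂ x‖₊ : ℝ≥0∞) ^ 2) ^ (1 / 2 : ℝ)) := by
        gcongr ENNReal.ofReal C * ((ENNReal.ofReal ℓ ^ 3) ^ (1 / 2 : ℝ) * ?_ ^ (1 / 2 : ℝ))
        exact lintegral_nnnorm_sq_projQ_le hℓ u hd

end Contraction

/-! ### Approximation by the cubic partial sums -/

section Approximation

variable {ℓ L : ℝ}

/-- The partial sums as explicit trigonometric polynomials. [folklore] -/
theorem partialSum_eq (L : ℝ) (φ : Space → ℂ) (N : ℕ) :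
    partialSum L φ N = fun y => ∑ n ∈ Finset.Icc (-(N : Fin 3 → ℤ)) (N : Fin 3 → ℤ),
      cellFourierCoeff L φ n * cellWave L n y := rfl

/-- The partial sums are continuous. [folklore] -/
theorem continuous_partialSum (L : ℝ) (φ : Space → ℂ) (N : ℕ) : Continuous (partialSum L φ N) :=
  (contDiff_partialSum L φ N).continuous

/-- `‖S_Nφ - φ‖₊²` is `Lℤ³`-periodic. [folklore] -/
theorem nnnorm_sq_partialSum_sub_add_latticeVec (hL : L ≠ 0) {φ : Space → ℂ}
    (hper : ∀ (x : Space) (k : Fin 3), φ (x + EuclideanSpace.single k L) = φ x) (N : ℕ) (x : Space)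
    (m : Fin 3 → ℤ) :
    ((‖partialSum L φ N (x + latticeVec L m) - φ (x + latticeVec L m)‖₊ : ℝ≥0∞) ^ 2) =
      (‖partialSum L φ N x - φ x‖₊ : ℝ≥0∞) ^ 2 := by
  rw [periodic_latticeVec hper, periodic_latticeVec (φ := partialSum L φ N)
    (fun y k => partialSum_periodic hL φ N y k)]

/-- **`L²(Λ(u))` convergence of the partial sums** (from `L²(Ω)` convergence, `ℓ < L`).
[folklore] -/
theorem tendsto_lintegral_slidingBox_sq_partialSum_sub (hℓ : 0 ≤ ℓ) (hℓL : ℓ < L) {φ : Space → ℂ}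
    (hφ : Continuous φ) (hper : ∀ (x : Space) (k : Fin 3), φ (x + EuclideanSpace.single k L) = φ x)
    (u : Space) :
    Tendsto (fun N => ∫⁻ x in slidingBox ℓ u, (‖partialSum L φ N x - φ x‖₊ : ℝ≥0∞) ^ 2) atTop
      (𝓝 0) := by
  have hL : 0 < L := lt_of_le_of_lt hℓ hℓL
  refine tendsto_of_tendsto_of_tendsto_of_le_of_le tendsto_const_nhds
    (tendsto_lintegral_sq_partialSum_sub hL hφ) (fun _ => bot_le) fun N => ?_
  exact lintegral_slidingBox_le_cell hℓ hℓL
    ((((continuous_partialSum L φ N).sub hφ).measurable.nnnorm).coe_nnreal_ennreal.pow_const _)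
    (nnnorm_sq_partialSum_sub_add_latticeVec hL.ne' hper N) u

/-- **Pointwise convergence of the Fourier transforms of the localised partial sums**:
`𝓕(χ_uQ_uS_Nφ)(p) → 𝓕(χ_uQ_uφ)(p)` (`|𝓕f - 𝓕g| ≤ ‖f - g‖₁` and the `L¹` bound). [folklore] -/
theorem tendsto_fourier_locProjQ_partialSum {χ : Space → ℝ} (hχ : IsLocalizationFunction χ)
    (hℓ : 0 < ℓ) (hℓL : ℓ < L) {φ : Space → ℂ} (hφ : Continuous φ)
    (hper : ∀ (x : Space) (k : Fin 3), φ (x + EuclideanSpace.single k L) = φ x) (u p : Space) :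
    Tendsto (fun N => 𝓕 (fun x => (locFun χ ℓ u x : ℂ) * projQ ℓ u (partialSum L φ N) x) p) atTop
      (𝓝 (𝓕 (fun x => (locFun χ ℓ u x : ℂ) * projQ ℓ u φ x) p)) := by
  obtain ⟨C, hC⟩ := hχ.exists_bound
  set K : ℝ≥0∞ := ENNReal.ofReal C * (ENNReal.ofReal ℓ ^ 3) ^ (1 / 2 : ℝ) with hK
  have hKtop : K ≠ ⊤ := ENNReal.mul_ne_top ENNReal.ofReal_ne_top
    (ENNReal.rpow_ne_top_of_nonneg (by norm_num) (ENNReal.pow_ne_top ENNReal.ofReal_ne_top))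
  have hE := tendsto_lintegral_slidingBox_sq_partialSum_sub hℓ.le hℓL hφ hper u
  have hE' : Tendsto (fun N => K * (∫⁻ x in slidingBox ℓ u,
      (‖partialSum L φ N x - φ x‖₊ : ℝ≥0∞) ^ 2) ^ (1 / 2 : ℝ)) atTop (𝓝 0) := by
    have h := ENNReal.Tendsto.const_mul (hE.ennrpow_const (1 / 2 : ℝ)) (Or.inr hKtop) (a := K)
    rwa [ENNReal.zero_rpow_of_pos (by norm_num), mul_zero] at h
  rw [tendsto_iff_edist_tendsto_0]
  refine tendsto_of_tendsto_of_tendsto_of_le_of_le tendsto_const_nhds hE' (fun _ => bot_le) fun N => ?_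
  have hi1 := integrable_locProjQ hχ ℓ u (integrableOn_slidingBox (continuous_partialSum L φ N) ℓ u)
  have hi2 := integrable_locProjQ hχ ℓ u (integrableOn_slidingBox hφ ℓ u)
  calc edist (𝓕 (fun x => (locFun χ ℓ u x : ℂ) * projQ ℓ u (partialSum L φ N) x) p)
        (𝓕 (fun x => (locFun χ ℓ u x : ℂ) * projQ ℓ u φ x) p)
      = ‖𝓕 (fun x => (locFun χ ℓ u x : ℂ) * projQ ℓ u (partialSum L φ N) x) p -
          𝓕 (fun x => (locFun χ ℓ u x : ℂ) * projQ ℓ u φ x) p‖ₑ := edist_eq_enorm_sub _ _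
    _ ≤ ∫⁻ x, ‖(locFun χ ℓ u x : ℂ) * projQ ℓ u (partialSum L φ N) x -
          (locFun χ ℓ u x : ℂ) * projQ ℓ u φ x‖ₑ := by
        have hi12 : Integrable (fun x => (locFun χ ℓ u x : ℂ) * projQ ℓ u (partialSum L φ N) x -
            (locFun χ ℓ u x : ℂ) * projQ ℓ u φ x) := hi1.sub hi2
        rw [← ofReal_norm, ← ofReal_integral_norm_eq_lintegral_enorm hi12]
        exact ENNReal.ofReal_le_ofReal (norm_fourier_sub_le hi1 hi2 p)
    _ ≤ K * (∫⁻ x in slidingBox ℓ u, (‖partialSum L φ N x - φ x‖₊ : ℝ≥0∞) ^ 2) ^ (1 / 2 : ℝ) := by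
        rw [hK, mul_assoc]
        exact lintegral_enorm_locProjQ_sub_le hC hℓ u (continuous_partialSum L φ N) hφ

/-- **The Fourier side is lower semicontinuous along the partial sums** (Fatou in `p`):
`∫τ|𝓕(χ_uQ_uφ)|² ≤ liminf_N ∫τ|𝓕(χ_uQ_uS_Nφ)|²`. [cite: Fournais2020, (3.13)] -/
theorem fourierPart_le_liminf {χ : Space → ℝ} (hχ : IsLocalizationFunction χ) (hℓ : 0 < ℓ)
    (hℓL : ℓ < L) (s : ℝ) {φ : Space → ℂ} (hφ : Continuous φ)
    (hper : ∀ (x : Space) (k : Fin 3), φ (x + EuclideanSpace.single k L) = φ x) (u : Space) :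
    ∫⁻ p, ENNReal.ofReal (4 * Real.pi ^ 2 * ‖p‖ ^ 2 - (s * ℓ)⁻¹ ^ 2) *
        (‖𝓕 (fun x => (locFun χ ℓ u x : ℂ) * projQ ℓ u φ x) p‖₊ : ℝ≥0∞) ^ 2 ≤
      liminf (fun N => ∫⁻ p, ENNReal.ofReal (4 * Real.pi ^ 2 * ‖p‖ ^ 2 - (s * ℓ)⁻¹ ^ 2) *
        (‖𝓕 (fun x => (locFun χ ℓ u x : ℂ) * projQ ℓ u (partialSum L φ N) x) p‖₊ : ℝ≥0∞) ^ 2)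
        atTop := by
  set τ : Space → ℝ≥0∞ := fun p => ENNReal.ofReal (4 * Real.pi ^ 2 * ‖p‖ ^ 2 - (s * ℓ)⁻¹ ^ 2) with hτ
  have hpt : ∀ p : Space, Tendsto (fun N => τ p *
      (‖𝓕 (fun x => (locFun χ ℓ u x : ℂ) * projQ ℓ u (partialSum L φ N) x) p‖₊ : ℝ≥0∞) ^ 2) atTop
      (𝓝 (τ p * (‖𝓕 (fun x => (locFun χ ℓ u x : ℂ) * projQ ℓ u φ x) p‖₊ : ℝ≥0∞) ^ 2)) := by
    intro p
    have h := (tendsto_fourier_locProjQ_partialSum hχ hℓ hℓL hφ hper u p).nnnorm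
    have h2 := ((ENNReal.continuous_coe.tendsto _).comp h)
    have h3 := ((ENNReal.continuous_pow 2).tendsto _).comp h2
    exact ENNReal.Tendsto.const_mul h3 (Or.inr ENNReal.ofReal_ne_top)
  have hmeas : ∀ N : ℕ, Measurable fun p => τ p *
      (‖𝓕 (fun x => (locFun χ ℓ u x : ℂ) * projQ ℓ u (partialSum L φ N) x) p‖₊ : ℝ≥0∞) ^ 2 := by
    intro N
    refine (measurable_tau s ℓ).mul ?_
    exact (continuous_fourier (integrable_locProjQ hχ ℓ u (integrableOn_slidingBox
      (continuous_partialSum L φ N) ℓ u))).measurable.nnnorm.coe_nnreal_ennreal.pow_const _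
  calc ∫⁻ p, τ p * (‖𝓕 (fun x => (locFun χ ℓ u x : ℂ) * projQ ℓ u φ x) p‖₊ : ℝ≥0∞) ^ 2
      = ∫⁻ p, liminf (fun N => τ p *
          (‖𝓕 (fun x => (locFun χ ℓ u x : ℂ) * projQ ℓ u (partialSum L φ N) x) p‖₊ : ℝ≥0∞) ^ 2)
          atTop := lintegral_congr fun p => ((hpt p).liminf_eq).symm
    _ ≤ _ := lintegral_liminf_le hmeas

/-- Minkowski in `L²` for `ℂ`-valued functions, `ℝ≥0∞` form. [folklore] -/
theorem sqrt_lintegral_nnnorm_sq_add_le {f g : Space → ℂ} (hf : Measurable f) (hg : Measurable g) :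
    (∫⁻ x, (‖f x + g x‖₊ : ℝ≥0∞) ^ 2) ^ (1 / 2 : ℝ) ≤
      (∫⁻ x, (‖f x‖₊ : ℝ≥0∞) ^ 2) ^ (1 / 2 : ℝ) + (∫⁻ x, (‖g x‖₊ : ℝ≥0∞) ^ 2) ^ (1 / 2 : ℝ) := by
  have hM := ENNReal.lintegral_Lp_add_le (μ := (volume : Measure Space)) (p := (2 : ℝ))
    (f := fun x => (‖f x‖₊ : ℝ≥0∞)) (g := fun x => (‖g x‖₊ : ℝ≥0∞))
    hf.nnnorm.coe_nnreal_ennreal.aemeasurable hg.nnnorm.coe_nnreal_ennreal.aemeasurable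
    (by norm_num)
  simp only [ENNReal.rpow_two, Pi.add_apply] at hM
  refine le_trans ?_ hM
  gcongr with x
  exact_mod_cast nnnorm_add_le (f x) (g x)

/-- **Continuity of the `Q` side along the partial sums**: `‖Q_uS_Nφ‖² → ‖Q_uφ‖²`
(Minkowski and the contraction property of `Q_u`). [cite: Fournais2020, (3.5)] -/
theorem tendsto_projQPart_partialSum (hℓ : 0 < ℓ) (hℓL : ℓ < L) {φ : Space → ℂ} (hφ : Continuous φ)
    (hper : ∀ (x : Space) (k : Fin 3), φ (x + EuclideanSpace.single k L) = φ x) (u : Space) :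
    Tendsto (fun N => ∫⁻ x, (‖projQ ℓ u (partialSum L φ N) x‖₊ : ℝ≥0∞) ^ 2) atTop
      (𝓝 (∫⁻ x, (‖projQ ℓ u φ x‖₊ : ℝ≥0∞) ^ 2)) := by
  -- notation
  set B : ℝ≥0∞ := ∫⁻ x, (‖projQ ℓ u φ x‖₊ : ℝ≥0∞) ^ 2 with hB
  set BN : ℕ → ℝ≥0∞ := fun N => ∫⁻ x, (‖projQ ℓ u (partialSum L φ N) x‖₊ : ℝ≥0∞) ^ 2 with hBN
  set DN : ℕ → ℝ≥0∞ := fun N =>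
    ∫⁻ x, (‖projQ ℓ u (fun y => partialSum L φ N y - φ y) x‖₊ : ℝ≥0∞) ^ 2 with hDN
  have hSc : ∀ N, Continuous (partialSum L φ N) := continuous_partialSum L φ
  have hdc : ∀ N, Continuous fun y => partialSum L φ N y - φ y := fun N => (hSc N).sub hφ
  -- `D_N → 0`
  have hD : Tendsto DN atTop (𝓝 0) :=
    tendsto_of_tendsto_of_tendsto_of_le_of_le tendsto_const_nhds
      (tendsto_lintegral_slidingBox_sq_partialSum_sub hℓ.le hℓL hφ hper u) (fun _ => bot_le)
      fun N => lintegral_nnnorm_sq_projQ_le hℓ u (hdc N)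
  have hD' : Tendsto (fun N => DN N ^ (1 / 2 : ℝ)) atTop (𝓝 0) := by
    have := hD.ennrpow_const (1 / 2 : ℝ)
    rwa [ENNReal.zero_rpow_of_pos (by norm_num)] at this
  -- `B < ∞`
  have hBtop : B ≠ ⊤ := by
    refine ne_top_of_le_ne_top ?_ (lintegral_nnnorm_sq_projQ_le hℓ u hφ)
    have h := lintegral_slidingBox_nnnorm_sq_eq_ofReal hφ ℓ u
    rw [h]
    exact ENNReal.ofReal_ne_top
  -- Minkowski both ways
  have hmQ : ∀ ψ : Space → ℂ, Continuous ψ → Measurable (projQ ℓ u ψ) := fun ψ hψ =>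
    measurable_projQ ℓ u hψ.measurable
  have hup : ∀ N, BN N ^ (1 / 2 : ℝ) ≤ B ^ (1 / 2 : ℝ) + DN N ^ (1 / 2 : ℝ) := by
    intro N
    have h := sqrt_lintegral_nnnorm_sq_add_le (hmQ φ hφ) (hmQ _ (hdc N))
    refine le_trans (le_of_eq ?_) h
    congr 1
    refine lintegral_congr fun x => ?_
    rw [← projQ_sub (hSc N) hφ, add_sub_cancel]
  have hlow : ∀ N, B ^ (1 / 2 : ℝ) ≤ BN N ^ (1 / 2 : ℝ) + DN N ^ (1 / 2 : ℝ) := by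
    intro N
    have h := sqrt_lintegral_nnnorm_sq_add_le (hmQ _ (hSc N)) ((hmQ _ (hdc N)).neg)
    refine le_trans (le_of_eq ?_) (le_trans h (le_of_eq ?_))
    · congr 1
      refine lintegral_congr fun x => ?_
      rw [Pi.neg_apply, ← projQ_sub (hSc N) hφ, neg_sub, add_sub_cancel]
    · congr 2
      refine lintegral_congr fun x => ?_
      rw [Pi.neg_apply, nnnorm_neg]
  -- squeeze for the square roots
  have hsqrt : Tendsto (fun N => BN N ^ (1 / 2 : ℝ)) atTop (𝓝 (B ^ (1 / 2 : ℝ))) := by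
    have hBt : B ^ (1 / 2 : ℝ) ≠ ⊤ := ENNReal.rpow_ne_top_of_nonneg (by norm_num) hBtop
    have h_upper : Tendsto (fun N => B ^ (1 / 2 : ℝ) + DN N ^ (1 / 2 : ℝ)) atTop
        (𝓝 (B ^ (1 / 2 : ℝ))) := by
      simpa using tendsto_const_nhds.add hD'
    have h_lower : Tendsto (fun N => B ^ (1 / 2 : ℝ) - DN N ^ (1 / 2 : ℝ)) atTop
        (𝓝 (B ^ (1 / 2 : ℝ))) := by
      simpa using ENNReal.Tendsto.sub tendsto_const_nhds hD' (Or.inl hBt)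
    refine tendsto_of_tendsto_of_tendsto_of_le_of_le h_lower h_upper (fun N => ?_) hup
    exact tsub_le_iff_right.2 (hlow N)
  -- square
  have hsq : ∀ x : ℝ≥0∞, (x ^ (1 / 2 : ℝ)) ^ (2 : ℝ) = x := fun x => by
    rw [← ENNReal.rpow_mul]; norm_num
  have h := hsqrt.ennrpow_const (2 : ℝ)
  simp only [hsq] at h
  exact h

end Approximation

/-! ### (3.19) for general `φ`: `ℓ⁻³∫_Ω⟨φ,T_uφ⟩du ≤ L³∑ₙ|ĉₙ|²F(n)ℓ³·ℓ⁻³` -/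

section General

variable {ℓ L : ℝ}

/-- A `liminf` of a sequence bounded by a constant is at most that constant. [folklore] -/
theorem liminf_le_of_forall_le {u : ℕ → ℝ≥0∞} {a : ℝ≥0∞} (h : ∀ N, u N ≤ a) :
    liminf u atTop ≤ a :=
  liminf_le_of_le (by isBoundedDefault) fun b hb => by
    obtain ⟨N, hN⟩ := hb.exists
    exact hN.trans (h N)

/-- **Fournais 2020, (3.19)–(3.20) for a general one-body function.** For continuous
`Lℤ³`-periodic `φ` with Fourier coefficients `ĉₙ`, and `ℓ < L`:
`∫_Ω ⟨φ, T_u φ⟩ du ≤ L³ ∑ₙ |ĉₙ|² ⟨e_n, T_0 e_n⟩` (with equality in the paper's `L²` setting; the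
inequality is what (3.14) uses). Proof: (3.19) for the cubic partial sums `S_Nφ`, Fatou in `u`, and,
for each `u`, lower semicontinuity of the Fourier side and continuity of the `Q` side along
`S_Nφ → φ`. [cite: Fournais2020, (3.19)–(3.20)] -/
theorem lintegral_cell_kinLoc_le_tsum {χ : Space → ℝ} (hχ : IsLocalizationFunction χ) (hℓ : 0 < ℓ)
    (hℓL : ℓ < L) (s b : ℝ) {φ : Space → ℂ} (hφ : Continuous φ)
    (hper : ∀ (x : Space) (k : Fin 3), φ (x + EuclideanSpace.single k L) = φ x) :
    ∫⁻ u in cell L, kinLoc χ ℓ s b u φ ≤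
      ENNReal.ofReal L ^ 3 * ∑' n : Fin 3 → ℤ,
        (‖cellFourierCoeff L φ n‖₊ : ℝ≥0∞) ^ 2 * kinLoc χ ℓ s b 0 (cellWave L n) := by
  have hL : 0 < L := hℓ.trans hℓL
  -- notation: the two sides of `kinLoc`
  set τ : Space → ℝ≥0∞ := fun p => ENNReal.ofReal (4 * Real.pi ^ 2 * ‖p‖ ^ 2 - (s * ℓ)⁻¹ ^ 2) with hτ
  set c : ℝ≥0∞ := ENNReal.ofReal (b / ℓ ^ 2) with hc
  set FP : Space → (Space → ℂ) → ℝ≥0∞ := fun u ψ =>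
    ∫⁻ p, τ p * (‖𝓕 (fun x => (locFun χ ℓ u x : ℂ) * projQ ℓ u ψ x) p‖₊ : ℝ≥0∞) ^ 2 with hFP
  set QP : Space → (Space → ℂ) → ℝ≥0∞ := fun u ψ =>
    ∫⁻ x, (‖projQ ℓ u ψ x‖₊ : ℝ≥0∞) ^ 2 with hQP
  have hkin : ∀ (u : Space) (ψ : Space → ℂ), kinLoc χ ℓ s b u ψ = FP u ψ + c * QP u ψ := fun u ψ => rfl
  set α : (Fin 3 → ℤ) → ℂ := fun n => cellFourierCoeff L φ n with hα
  set S : ℕ → Finset (Fin 3 → ℤ) := fun N => Finset.Icc (-(N : Fin 3 → ℤ)) (N : Fin 3 → ℤ) with hS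
  have hPS : ∀ N, partialSum L φ N = fun y => ∑ n ∈ S N, α n * cellWave L n y := fun N => rfl
  -- pointwise lower semicontinuity in `u`
  have hptF : ∀ u : Space, FP u φ ≤ liminf (fun N => FP u (partialSum L φ N)) atTop := fun u =>
    fourierPart_le_liminf hχ hℓ hℓL s hφ hper u
  have hptQ : ∀ u : Space, QP u φ ≤ liminf (fun N => QP u (partialSum L φ N)) atTop := fun u =>
    ((tendsto_projQPart_partialSum hℓ hℓL hφ hper u).liminf_eq).symm.le
  -- measurability in `u` along the partial sums
  have hmF : ∀ N : ℕ, Measurable fun u => FP u (partialSum L φ N) := fun N => by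
    simp only [hFP, hPS]
    exact measurable_fourierPart_trigPoly hχ ℓ L s (S N) α
  have hmQ : ∀ N : ℕ, Measurable fun u => QP u (partialSum L φ N) := fun N => by
    simp only [hQP, hPS]
    exact measurable_projQPart_trigPoly ℓ L (S N) α
  -- (3.19) along the partial sums
  have hidF : ∀ N : ℕ, ∫⁻ u in cell L, FP u (partialSum L φ N) =
      ENNReal.ofReal L ^ 3 * ∑ n ∈ S N, (‖α n‖₊ : ℝ≥0∞) ^ 2 * FP 0 (cellWave L n) := fun N => by
    simp only [hFP, hPS]
    exact lintegral_cell_fourierPart_trigPoly hχ hL ℓ s (S N) α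
  have hidQ : ∀ N : ℕ, ∫⁻ u in cell L, QP u (partialSum L φ N) =
      ENNReal.ofReal L ^ 3 * ∑ n ∈ S N, (‖α n‖₊ : ℝ≥0∞) ^ 2 * QP 0 (cellWave L n) := fun N => by
    simp only [hQP, hPS]
    exact lintegral_cell_projQPart_trigPoly hL ℓ (S N) α
  -- partial sums are bounded by the full sums
  have hbdF : ∀ N : ℕ, ∫⁻ u in cell L, FP u (partialSum L φ N) ≤
      ENNReal.ofReal L ^ 3 * ∑' n, (‖α n‖₊ : ℝ≥0∞) ^ 2 * FP 0 (cellWave L n) := fun N => by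
    rw [hidF]
    exact mul_le_mul_right (ENNReal.sum_le_tsum _) _
  have hbdQ : ∀ N : ℕ, ∫⁻ u in cell L, QP u (partialSum L φ N) ≤
      ENNReal.ofReal L ^ 3 * ∑' n, (‖α n‖₊ : ℝ≥0∞) ^ 2 * QP 0 (cellWave L n) := fun N => by
    rw [hidQ]
    exact mul_le_mul_right (ENNReal.sum_le_tsum _) _
  -- assemble
  calc ∫⁻ u in cell L, kinLoc χ ℓ s b u φ
      = ∫⁻ u in cell L, (FP u φ + c * QP u φ) := by simp only [hkin]
    _ ≤ ∫⁻ u in cell L, (liminf (fun N => FP u (partialSum L φ N)) atTop +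
          c * liminf (fun N => QP u (partialSum L φ N)) atTop) :=
        lintegral_mono fun u => add_le_add (hptF u) (mul_le_mul_right (hptQ u) _)
    _ = (∫⁻ u in cell L, liminf (fun N => FP u (partialSum L φ N)) atTop) +
          c * ∫⁻ u in cell L, liminf (fun N => QP u (partialSum L φ N)) atTop := by
        rw [lintegral_add_left (Measurable.liminf hmF), lintegral_const_mul _ (Measurable.liminf hmQ)]
    _ ≤ liminf (fun N => ∫⁻ u in cell L, FP u (partialSum L φ N)) atTop +
          c * liminf (fun N => ∫⁻ u in cell L, QP u (partialSum L φ N)) atTop :=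
        add_le_add (lintegral_liminf_le hmF) (mul_le_mul_right (lintegral_liminf_le hmQ) _)
    _ ≤ ENNReal.ofReal L ^ 3 * ∑' n, (‖α n‖₊ : ℝ≥0∞) ^ 2 * FP 0 (cellWave L n) +
          c * (ENNReal.ofReal L ^ 3 * ∑' n, (‖α n‖₊ : ℝ≥0∞) ^ 2 * QP 0 (cellWave L n)) :=
        add_le_add (liminf_le_of_forall_le hbdF) (mul_le_mul_right (liminf_le_of_forall_le hbdQ) _)
    _ = ENNReal.ofReal L ^ 3 * ∑' n, (‖α n‖₊ : ℝ≥0∞) ^ 2 * kinLoc χ ℓ s b 0 (cellWave L n) := by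
        simp only [hkin, mul_add, ENNReal.tsum_add, ← ENNReal.tsum_mul_left]
        congr 1
        refine tsum_congr fun n => ?_
        ring

end General

/-! ### Lemma 3.3 from (3.21) -/

section Assembly

variable {ℓ L : ℝ}

/-- `⟨1, T_u 1⟩ = 0`: the localised kinetic energy kills the constants (`Q_u 1 = 0`), i.e.
`F(0) = 0`. [cite: Fournais2020, (3.5), (3.13)] -/
theorem kinLoc_cellWave_zero (χ : Space → ℝ) (hℓ : 0 < ℓ) (L s b : ℝ) (u : Space) :
    kinLoc χ ℓ s b u (cellWave L 0) = 0 := by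
  have h1 : cellWave L 0 = fun _ => (1 : ℂ) := funext (cellWave_zero L)
  rw [h1]
  unfold kinLoc
  simp only [projQ_const hℓ u (1 : ℂ), Pi.zero_apply, mul_zero, nnnorm_zero, ENNReal.coe_zero,
    ne_eq, OfNat.ofNat_ne_zero, not_false_eq_true, zero_pow, lintegral_const, zero_mul, mul_zero,
    add_zero]
  have h0 : (𝓕 (fun _ : Space => (0 : ℂ)) : Space → ℂ) = 0 := by
    funext p
    rw [Real.fourier_eq]
    simp
  simp [h0]

/-- `L³ ‖ĉ₀‖₊² = L⁻³ ‖∫_Ω φ‖₊²` (the mean). [folklore] -/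
theorem ofReal_mul_nnnorm_sq_cellFourierCoeff_zero (hL : 0 < L) (φ : Space → ℂ) :
    ENNReal.ofReal L ^ 3 * (‖cellFourierCoeff L φ 0‖₊ : ℝ≥0∞) ^ 2 =
      (ENNReal.ofReal L ^ 3)⁻¹ * (‖∫ x in cell L, φ x‖₊ : ℝ≥0∞) ^ 2 := by
  have hK0 : ENNReal.ofReal L ^ 3 ≠ 0 := pow_ne_zero _ (by simpa using hL)
  have hKtop : ENNReal.ofReal L ^ 3 ≠ ⊤ := ENNReal.pow_ne_top ENNReal.ofReal_ne_top
  rw [cellFourierCoeff_zero hL, nnnorm_smul, ENNReal.coe_mul, mul_pow, ← mul_assoc]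
  congr 1
  have h : ((‖((L ^ 3)⁻¹ : ℝ)‖₊ : ℝ≥0∞)) = (ENNReal.ofReal L ^ 3)⁻¹ := by
    rw [← enorm_eq_nnnorm, ← ofReal_norm, Real.norm_eq_abs, abs_of_pos (by positivity),
      ENNReal.ofReal_inv_of_pos (by positivity), ENNReal.ofReal_pow hL.le]
  rw [h, pow_two, ← mul_assoc, ENNReal.mul_inv_cancel hK0 hKtop, one_mul]

/-- **Fournais 2020, Lemma 3.3 from the multiplier bound (3.21).**
`Fournais2020_eq321 → Fournais2020_lemma33`: with `b, s₀` from (3.21), for `s ≤ s₀`, `2ℓ < L`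
and a `C¹` periodic `φ` with Fourier coefficients `ĉₙ`,
`ℓ⁻³∫_Ω⟨φ,T_uφ⟩du + 2π²L⁻²‖φ‖² ≤ L³∑ₙ(F(n) + 2π²L⁻²)|ĉₙ|² ≤ L³(2π²L⁻²|ĉ₀|² + ∑ₙ4π²|n|²L⁻²|ĉₙ|²)
= 2π²L⁻²L⁻³|∫_Ωφ|² + ∫_Ω|∇φ|²` ((3.19)–(3.20) as an inequality for `φ`, `F(0) = 0`, Parseval for
`φ`, its mean and its gradient). [cite: Fournais2020, Lemma 3.3 (3.12)–(3.13), (3.19)–(3.21)] -/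
theorem Fournais2020_lemma33_of_eq321 (h321 : Fournais2020_eq321) : Fournais2020_lemma33 := by
  intro χ hχ
  obtain ⟨b, s₀, hb, hs₀, H⟩ := h321 χ hχ
  refine ⟨b, s₀, hb, hs₀, fun s hs hss₀ ℓ L hℓ hℓL φ hφ hper => ?_⟩
  have hL : 0 < L := by linarith
  have hℓL' : ℓ < L := by linarith
  have H' := H s hs hss₀ ℓ L hℓ hℓL
  -- notation
  set g : ℝ≥0∞ := ENNReal.ofReal (2 * Real.pi ^ 2 / L ^ 2) with hg
  set cc : (Fin 3 → ℤ) → ℝ≥0∞ := fun n => (‖cellFourierCoeff L φ n‖₊ : ℝ≥0∞) ^ 2 with hcc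
  set F : (Fin 3 → ℤ) → ℝ≥0∞ := fun n => (ENNReal.ofReal ℓ ^ 3)⁻¹ * kinLoc χ ℓ s b 0 (cellWave L n)
    with hF
  set kk : (Fin 3 → ℤ) → ℝ≥0∞ := fun n =>
    ENNReal.ofReal (4 * Real.pi ^ 2 * (∑ j, (n j : ℝ) ^ 2) / L ^ 2) with hkk
  have hK0 : ENNReal.ofReal L ^ 3 ≠ 0 := pow_ne_zero _ (by simpa using hL)
  have hKtop : ENNReal.ofReal L ^ 3 ≠ ⊤ := ENNReal.pow_ne_top ENNReal.ofReal_ne_top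
  have hℓ3top : (ENNReal.ofReal ℓ ^ 3)⁻¹ ≠ ⊤ :=
    ENNReal.inv_ne_top.2 (pow_ne_zero _ (by simpa using hℓ))
  -- Step 1: the kinetic term
  have h1 : (ENNReal.ofReal ℓ ^ 3)⁻¹ * (∫⁻ u in cell L, kinLoc χ ℓ s b u φ) ≤ ENNReal.ofReal L ^ 3 * ∑' n, cc n * F n := by
    calc (ENNReal.ofReal ℓ ^ 3)⁻¹ * (∫⁻ u in cell L, kinLoc χ ℓ s b u φ)
        ≤ (ENNReal.ofReal ℓ ^ 3)⁻¹ * (ENNReal.ofReal L ^ 3 * ∑' n, cc n * kinLoc χ ℓ s b 0 (cellWave L n)) :=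
          mul_le_mul_right (lintegral_cell_kinLoc_le_tsum hχ hℓ hℓL' s b hφ.continuous hper) _
      _ = ENNReal.ofReal L ^ 3 * ∑' n, cc n * F n := by
          rw [← mul_assoc, mul_comm _ (ENNReal.ofReal L ^ 3), mul_assoc, ← ENNReal.tsum_mul_left]
          congr 1
          refine tsum_congr fun n => ?_
          simp only [hF]
          ring
  -- Step 2: the mass term (Parseval)
  have h2 : g * ∫⁻ x in cell L, (‖φ x‖₊ : ℝ≥0∞) ^ 2 = ENNReal.ofReal L ^ 3 * ∑' n, cc n * g := by
    rw [ENNReal.tsum_mul_right, hcc, tsum_sq_cellFourierCoeff hL hφ.continuous, ← mul_assoc,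
      ← mul_assoc, ENNReal.mul_inv_cancel hK0 hKtop, one_mul, mul_comm]
  -- Step 3: the multiplier bound, termwise (with `F(0) = 0`)
  have h3 : ∀ n, cc n * F n + cc n * g ≤ cc n * kk n + if n = 0 then cc 0 * g else 0 := by
    intro n
    by_cases hn : n = 0
    · subst hn
      simp only [hF, kinLoc_cellWave_zero χ hℓ L s b 0, mul_zero, if_true, zero_add]
      exact le_add_self
    · rw [if_neg hn, add_zero, ← mul_add]
      exact mul_le_mul_right (H' n hn) _
  have h3' : ∑' n, (cc n * F n + cc n * g) ≤ (∑' n, cc n * kk n) + cc 0 * g := by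
    calc ∑' n, (cc n * F n + cc n * g) ≤ ∑' n, (cc n * kk n + if n = 0 then cc 0 * g else 0) :=
          ENNReal.tsum_le_tsum h3
      _ = (∑' n, cc n * kk n) + cc 0 * g := by rw [ENNReal.tsum_add, tsum_ite_eq]
  -- Step 4: identify the right-hand side (gradient Parseval, mean)
  have h4 : ENNReal.ofReal L ^ 3 * ∑' n, cc n * kk n = ∫⁻ x in cell L, gradSqC φ x := by
    have hP := tsum_sq_grad_cellFourierCoeff hL hφ hper
    have : ∑' n, cc n * kk n = ∑' n, kk n * cc n := tsum_congr fun n => mul_comm _ _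
    rw [this, hP, ← mul_assoc, ENNReal.mul_inv_cancel hK0 hKtop, one_mul]
    rfl
  have h5 : ENNReal.ofReal L ^ 3 * (cc 0 * g) = g * ((ENNReal.ofReal L ^ 3)⁻¹ * (‖∫ x in cell L, φ x‖₊ : ℝ≥0∞) ^ 2) := by
    rw [← mul_assoc, hcc, ofReal_mul_nnnorm_sq_cellFourierCoeff_zero hL φ, mul_comm]
  -- assemble
  calc (ENNReal.ofReal ℓ ^ 3)⁻¹ * (∫⁻ u in cell L, kinLoc χ ℓ s b u φ) +
        g * ∫⁻ x in cell L, (‖φ x‖₊ : ℝ≥0∞) ^ 2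
      ≤ ENNReal.ofReal L ^ 3 * ∑' n, cc n * F n + ENNReal.ofReal L ^ 3 * ∑' n, cc n * g := add_le_add h1 h2.le
    _ = ENNReal.ofReal L ^ 3 * ∑' n, (cc n * F n + cc n * g) := by rw [ENNReal.tsum_add, mul_add]
    _ ≤ ENNReal.ofReal L ^ 3 * ((∑' n, cc n * kk n) + cc 0 * g) := mul_le_mul_right h3' _
    _ = (∫⁻ x in cell L, gradSqC φ x) +
        g * ((ENNReal.ofReal L ^ 3)⁻¹ * (‖∫ x in cell L, φ x‖₊ : ℝ≥0∞) ^ 2) := by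
        rw [mul_add, h4, h5]

end Assembly





end Literature.MathematicalPhysics.QuantumManyBody.BoseGas
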